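import Literature.NumberTheory.Sieve.HeathBrownCubicApproxUA
import HarnessLib

/-!
# Heath-Brown's Lemma 3.7 from Lemma 7.1, VIII: the `U`-bounds for `ℬ^(K)`

Pure-proof file (no definitions) in the deduction of **Lemma 3.7 from the corrected Lemma 7.1** of
D. R. Heath-Brown, *Primes represented by `x³ + 2y³`*, Acta Math. 186 (2001), 1–84, §7 pp. 42–47
(decomposition of **parity.S18**, `Literature.NumberTheory.Sieve.setOf_prime_cube_add_two_mul_cube_infinite`).

`U_sum_bound` (`HeathBrownCubicApproxUSum`) bounds `∑_n |U₁^(n) − Û^(n)|` for a general family by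
three family-dependent terms E1 (non-good chain indices), E3ii (Buchstab primes of degree `≥ 2` or
repeated norm), E4 (square-free defect) plus `O(τ M/log X)`. For `ℬ^(K)` all three are handled by
the crude count (7.7), `#ℬ^(K)_R ≤ C_B X³/N(R)` (`exists_countB_le`), and polynomial savings
`X^{−τ/3}` from prime ideals of degree `≥ 2` / pairs of equal norm above `X^τ`:

* `squarefree_absNorm_of_factors`, `exists_divisor_of_defect` — a rough cofactor `R` with `N(R)`
  not square-free is divisible by a prime of degree `≥ 2`, by `P²`, or by `PP'` with `N(P) = N(P')`;
* `defect_count_B_le`, `defect_weights_B_le`, `sum_inv_absNorm_tuples_le`, `E4_B_le` — E4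
  `≤ C_B X³ W₄ ê_{n+1}`, `W₄ ≪ X^{−τ/3}`, `ê_j` the elementary symmetric sums of `N(P)^{-1}` over `𝒫₀`;
* `E3ii_B_le` — E3ii `≤ C_B X³ (W₁ + 3(n+1)X^{−τ}) ê_{n+1}` (at most `3` prime ideals share a norm);
* `insert_injOn_Upairs`, `E1_B_le` — E1 `≤ C_B X³ (W₁' ê_n + W₂ ê_{n−1})` (`sum_sel_le`, `sum_sel₂_le`);
* `sum_ehat_le`, `ehat_total_le`, `B_Eterms_le`, `B_final_absorb`, `U_B_sum_bound`, **`U_B_bounds`** —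
  `∑_{𝒫₀} N(P)^{-1} ≤ log(2/τ) + 2`, the sum over `n`, and the three `U`-conjuncts of Lemma 3.7 for
  `ℬ^(K)` (each `≤ C ξτ^{-4} ηX³/log X`), from `HeathBrown2001_lemma_7_1_normWeighted`.
-/

noncomputable section

open Polynomial NumberField Finset Filter Topology Asymptotics
open scoped nonZeroDivisors

namespace Literature.NumberTheory.Sieve.CubicSieve

open LFunctions.CubeRootTwoField CubicPrimes
open Literature.NumberTheory.LFunctions (idealNormCount)

section FamilyB

variable {X η τ : ℝ} {n : ℕ}

/-! ### Square-free norms and the defect dichotomy -/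

/-- A nonzero square-free ideal whose prime factors have prime, pairwise distinct norms has
square-free norm (the mechanism of Lemma 3.1, abstracted). [cite: HeathBrownActa2001, Lemma 3.1] -/
theorem squarefree_absNorm_of_factors {R : Ideal (𝓞 K)} (hR0 : R ≠ ⊥) (hR : Squarefree R)
    (hprime : ∀ P : Ideal (𝓞 K), P.IsPrime → P ∣ R → (Ideal.absNorm P).Prime)
    (hinj : ∀ P P' : Ideal (𝓞 K), P.IsPrime → P'.IsPrime → P ∣ R → P' ∣ R →
      Ideal.absNorm P = Ideal.absNorm P' → P = P') :
    Squarefree (Ideal.absNorm R) := by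
  classical
  set F := UniqueFactorizationMonoid.normalizedFactors R with hF
  have hnodup : F.Nodup :=
    (UniqueFactorizationMonoid.squarefree_iff_nodup_normalizedFactors hR0).1 hR
  have hmemF : ∀ P ∈ F, P.IsPrime ∧ P ∣ R := by
    intro P hP
    have h := (Ideal.mem_normalizedFactors_iff hR0).1 hP
    exact ⟨h.1, Ideal.dvd_iff_le.mpr h.2⟩
  have hprod : Ideal.absNorm R = (F.map Ideal.absNorm).prod := by
    conv_lhs => rw [← Ideal.prod_normalizedFactors_eq_self hR0]
    rw [← hF, map_multiset_prod]
  have hprime' : ∀ m ∈ F.map Ideal.absNorm, m.Prime := by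
    intro m hm
    obtain ⟨P, hP, rfl⟩ := Multiset.mem_map.1 hm
    exact hprime P (hmemF P hP).1 (hmemF P hP).2
  have hnodup' : (F.map Ideal.absNorm).Nodup := by
    refine Multiset.Nodup.map_on (fun P hP P' hP' hN => ?_) hnodup
    exact hinj P P' (hmemF P hP).1 (hmemF P' hP').1 (hmemF P hP).2 (hmemF P' hP').2 hN
  set l := (F.map Ideal.absNorm).toList with hl
  have hlF : (l : Multiset ℕ) = F.map Ideal.absNorm := Multiset.coe_toList _
  have hlprod : l.prod = Ideal.absNorm R := by rw [hprod, hl, Multiset.prod_toList]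
  have hlprime : ∀ m ∈ l, m.Prime := fun m hm => hprime' m (by rwa [hl, Multiset.mem_toList] at hm)
  have hn0 : Ideal.absNorm R ≠ 0 := by
    rw [← hlprod]
    exact List.prod_ne_zero fun h => (hlprime 0 h).ne_zero rfl
  rw [Nat.squarefree_iff_nodup_primeFactorsList hn0,
    ← (Nat.primeFactorsList_unique hlprod hlprime).nodup_iff, ← Multiset.coe_nodup, hlF]
  exact hnodup'

/-- Two distinct nonzero prime ideals dividing `R` divide it jointly. [folklore] -/
theorem mul_dvd_of_dvd_of_dvd_of_ne {R P P' : Ideal (𝓞 K)} (hP : P.IsPrime) (hP0 : P ≠ ⊥)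
    (hP' : P'.IsPrime) (hP'0 : P' ≠ ⊥) (hne : P ≠ P') (h1 : P ∣ R) (h2 : P' ∣ R) : P * P' ∣ R := by
  obtain ⟨R₁, rfl⟩ := h1
  have hpr : Prime P' := Ideal.prime_of_isPrime hP'0 hP'
  rcases hpr.dvd_or_dvd h2 with h | h
  · exfalso
    have hle : P ≤ P' := Ideal.dvd_iff_le.mp h
    have hmax : P.IsMaximal := Ring.DimensionLEOne.maximalOfPrime hP0 hP
    exact hne (hmax.eq_of_le hP'.ne_top hle)
  · exact mul_dvd_mul_left P h

/-- **The defect dichotomy for a rough cofactor.** If `R ≠ 0` is `z`-rough and `N(R)` is not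
square-free, then `R` is divisible by a prime `P` of degree `≥ 2` with `N(P) ≥ z`, or by `P²` for a
first-degree prime `P` with `N(P) ≥ z`, or by `PP'` for two distinct first-degree primes of the same
norm `≥ z` (otherwise `R` is square-free with factors of distinct prime norms, and `N(R)` would be
square-free). [cite: HeathBrownActa2001, §7 p. 45] -/
theorem exists_divisor_of_defect {R : Ideal (𝓞 K)} (hR0 : R ≠ ⊥)
    (hsq : ¬ Squarefree (Ideal.absNorm R)) {z : ℝ} (hrough : IsRough z R) :
    (∃ P : Ideal (𝓞 K), P.IsPrime ∧ P ≠ ⊥ ∧ P ∣ R ∧ ¬ (Ideal.absNorm P).Prime ∧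
        z ≤ (Ideal.absNorm P : ℝ)) ∨
    (∃ P : Ideal (𝓞 K), P.IsPrime ∧ P ≠ ⊥ ∧ P * P ∣ R ∧ (Ideal.absNorm P).Prime ∧
        z ≤ (Ideal.absNorm P : ℝ)) ∨
    (∃ P P' : Ideal (𝓞 K), P.IsPrime ∧ P ≠ ⊥ ∧ P'.IsPrime ∧ P' ≠ ⊥ ∧ P ≠ P' ∧ P * P' ∣ R ∧
        Ideal.absNorm P = Ideal.absNorm P' ∧ (Ideal.absNorm P).Prime ∧ z ≤ (Ideal.absNorm P : ℝ)) := by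
  classical
  have hne0 : ∀ P : Ideal (𝓞 K), P ∣ R → P ≠ ⊥ := by
    rintro P hP rfl
    exact hR0 (Ideal.dvd_iff_le.mp hP |>.antisymm bot_le ▸ rfl)
  by_cases h1 : ∃ P : Ideal (𝓞 K), P.IsPrime ∧ P ∣ R ∧ ¬ (Ideal.absNorm P).Prime
  · obtain ⟨P, hP, hPR, hnp⟩ := h1
    exact Or.inl ⟨P, hP, hne0 P hPR, hPR, hnp, hrough hP hPR⟩
  push Not at h1
  by_cases h2 : ∃ P P' : Ideal (𝓞 K), P.IsPrime ∧ P'.IsPrime ∧ P ∣ R ∧ P' ∣ R ∧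
      Ideal.absNorm P = Ideal.absNorm P' ∧ P ≠ P'
  · obtain ⟨P, P', hP, hP', hPR, hP'R, hN, hne⟩ := h2
    refine Or.inr (Or.inr ⟨P, P', hP, hne0 P hPR, hP', hne0 P' hP'R, hne, ?_, hN, h1 P hP hPR,
      hrough hP hPR⟩)
    exact mul_dvd_of_dvd_of_dvd_of_ne hP (hne0 P hPR) hP' (hne0 P' hP'R) hne hPR hP'R
  push Not at h2
  have hnsf : ¬ Squarefree R := fun hsf =>
    hsq (squarefree_absNorm_of_factors hR0 hsf h1 fun P P' hP hP' hPR hP'R hN => h2 P P' hP hP' hPR hP'R hN)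
  obtain ⟨Q, hQQ, hQu⟩ : ∃ Q : Ideal (𝓞 K), Q * Q ∣ R ∧ ¬ IsUnit Q := by
    by_contra h
    push Not at h
    exact hnsf h
  have hQtop : Q ≠ ⊤ := fun h => hQu (Ideal.isUnit_iff.mpr h)
  obtain ⟨P₀, hP₀max, hQP₀⟩ := Ideal.exists_le_maximal Q hQtop
  have hP₀ : P₀.IsPrime := hP₀max.isPrime
  have hP₀Q : P₀ ∣ Q := Ideal.dvd_iff_le.mpr hQP₀
  have hP₀R : P₀ * P₀ ∣ R := (mul_dvd_mul hP₀Q hP₀Q).trans hQQ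
  have hP₀R' : P₀ ∣ R := (dvd_mul_right P₀ P₀).trans hP₀R
  exact Or.inr (Or.inl ⟨P₀, hP₀, hne0 P₀ hP₀R', hP₀R, h1 P₀ hP₀ hP₀R', hrough hP₀ hP₀R'⟩)

/-! ### (E4) for `ℬ^(K)`: the square-free defect via (7.7) -/

open scoped Classical in
/-- **The square-free defect count for `ℬ^(K)` at a fixed divisor `S`** ((7.7) `#ℬ^(K)_R ≤ C_B X³/N(R)`):
the members `J` with `S ∣ J`, `X^τ`-rough, and `N(J)/N(S)` not square-free number at most
`C_B X³ N(S)^{-1} · W₄`, `W₄ = ∑_{P: deg ≥ 2, N(P) ≥ X^τ} N(P)^{-1} + ∑_{P: deg 1, N(P) ≥ X^τ} N(P)^{-2}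
 + ∑_{P ≠ P', N(P) = N(P') ≥ X^τ} N(P)^{-1}N(P')^{-1}` (primes of norm `≤ 6X³`), by the defect
dichotomy. [cite: HeathBrownActa2001, §7 (7.7), p. 45] -/
theorem defect_count_B_le (hX : 0 < X) (hη1 : η ≤ 1) {S : Ideal (𝓞 K)} (hS0 : S ≠ ⊥)
    {z : ℝ} (hz : X ^ τ ≤ z) {C_B : ℝ}
    (hcountB : ∀ R : Ideal (𝓞 K), R ≠ ⊥ → (countB X η R : ℝ) ≤ C_B * X ^ 3 / Ideal.absNorm R) :
    (#{J ∈ normWindow X η | S ∣ J ∧ IsRough z J ∧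
        ¬ Squarefree (Ideal.absNorm J / Ideal.absNorm S)} : ℝ) ≤
      C_B * X ^ 3 / Ideal.absNorm S *
        (∑ P ∈ (Literature.NumberTheory.LFunctions.NumberField.finite_primeIdealsLE K (6 * X ^ 3)).toFinset.filter
            (fun P => ¬ (Ideal.absNorm P).Prime ∧ X ^ τ ≤ (Ideal.absNorm P : ℝ)),
            ((Ideal.absNorm P : ℕ) : ℝ)⁻¹ +
         ∑ P ∈ (Literature.NumberTheory.LFunctions.NumberField.finite_primeIdealsLE K (6 * X ^ 3)).toFinset.filter
            (fun P => (Ideal.absNorm P).Prime ∧ X ^ τ ≤ (Ideal.absNorm P : ℝ)),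
            ((Ideal.absNorm P : ℕ) : ℝ)⁻¹ * ((Ideal.absNorm P : ℕ) : ℝ)⁻¹ +
         ∑ x ∈ ((Literature.NumberTheory.LFunctions.NumberField.finite_primeIdealsLE K (6 * X ^ 3)).toFinset.filter
              (fun P => (Ideal.absNorm P).Prime ∧ X ^ τ ≤ (Ideal.absNorm P : ℝ)) ×ˢ
            (Literature.NumberTheory.LFunctions.NumberField.finite_primeIdealsLE K (6 * X ^ 3)).toFinset.filter
              (fun P => (Ideal.absNorm P).Prime ∧ X ^ τ ≤ (Ideal.absNorm P : ℝ))).filter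
            (fun x => x.1 ≠ x.2 ∧ Ideal.absNorm x.1 = Ideal.absNorm x.2),
            ((Ideal.absNorm x.1 : ℕ) : ℝ)⁻¹ * ((Ideal.absNorm x.2 : ℕ) : ℝ)⁻¹) := by
  classical
  set PI := (Literature.NumberTheory.LFunctions.NumberField.finite_primeIdealsLE K (6 * X ^ 3)).toFinset with hPI
  set Dnp := PI.filter (fun P => ¬ (Ideal.absNorm P).Prime ∧ X ^ τ ≤ (Ideal.absNorm P : ℝ)) with hDnp
  set Dp := PI.filter (fun P => (Ideal.absNorm P).Prime ∧ X ^ τ ≤ (Ideal.absNorm P : ℝ)) with hDp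
  set Dpairs := (Dp ×ˢ Dp).filter (fun x => x.1 ≠ x.2 ∧ Ideal.absNorm x.1 = Ideal.absNorm x.2) with hDpairs
  set T := (normWindow X η).filter (fun J => S ∣ J ∧ IsRough z J ∧
    ¬ Squarefree (Ideal.absNorm J / Ideal.absNorm S)) with hT
  have hmemPI : ∀ {P : Ideal (𝓞 K)}, P.IsPrime → P ≠ ⊥ → (Ideal.absNorm P : ℝ) ≤ 6 * X ^ 3 → P ∈ PI := by
    intro P h1 h2 h3
    rw [hPI, Set.Finite.mem_toFinset]
    exact ⟨h1, h2, h3⟩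
  have hNS : 0 < Ideal.absNorm S := Nat.pos_of_ne_zero fun h => hS0 (Ideal.absNorm_eq_zero_iff.mp h)
  -- covering
  have hcover : T ⊆ (Dnp.biUnion fun P => BIdeals X η (S * P)) ∪
      ((Dp.biUnion fun P => BIdeals X η (S * (P * P))) ∪
        (Dpairs.biUnion fun x => BIdeals X η (S * (x.1 * x.2)))) := by
    intro J hJ
    rw [hT, mem_filter] at hJ
    obtain ⟨hJw, ⟨R, hR⟩, hrough, hsq⟩ := hJ
    have hJ0 : J ≠ ⊥ := ne_bot_of_mem_normWindow hX.le J hJw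
    have hR0 : R ≠ ⊥ := by rintro rfl; exact hJ0 (by rw [hR, Ideal.mul_bot])
    have hquot : Ideal.absNorm J / Ideal.absNorm S = Ideal.absNorm R := by
      rw [hR, map_mul, Nat.mul_div_cancel_left _ hNS]
    rw [hquot] at hsq
    have hRrough : IsRough z R := (isRough_mul_iff.mp (hR ▸ hrough)).2
    have hNJ : (Ideal.absNorm J : ℝ) ≤ 6 * X ^ 3 := (absNorm_normWindow_bounds hX hη1 hJw).2
    have hNR : (Ideal.absNorm R : ℝ) ≤ 6 * X ^ 3 := by
      have : Ideal.absNorm R ≤ Ideal.absNorm J := by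
        rw [hR, map_mul]; exact Nat.le_mul_of_pos_left _ hNS
      exact le_trans (by exact_mod_cast this) hNJ
    have hNle : ∀ {D : Ideal (𝓞 K)}, D ∣ R → (Ideal.absNorm D : ℝ) ≤ 6 * X ^ 3 := by
      intro D hD
      have hNR0 : 0 < Ideal.absNorm R := Nat.pos_of_ne_zero fun h => hR0 (Ideal.absNorm_eq_zero_iff.mp h)
      have : Ideal.absNorm D ≤ Ideal.absNorm R := Nat.le_of_dvd hNR0 (map_dvd Ideal.absNorm hD)
      exact le_trans (by exact_mod_cast this) hNR
    have hSD : ∀ {D : Ideal (𝓞 K)}, D ∣ R → S * D ∣ J := by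
      intro D hD; rw [hR]; exact mul_dvd_mul_left S hD
    rcases exists_divisor_of_defect hR0 hsq hRrough with ⟨P, hP, hP0, hPR, hnp, hzP⟩ |
      ⟨P, hP, hP0, hPR, hp, hzP⟩ | ⟨P, P', hP, hP0, hP', hP'0, hne, hPR, hN, hp, hzP⟩
    · refine mem_union_left _ (mem_biUnion.mpr ⟨P, ?_, mem_BIdeals_iff.mpr ⟨hJw, hSD hPR⟩⟩)
      rw [hDnp, mem_filter]
      exact ⟨hmemPI hP hP0 (hNle hPR), hnp, hz.trans hzP⟩
    · refine mem_union_right _ (mem_union_left _ (mem_biUnion.mpr ⟨P, ?_, mem_BIdeals_iff.mpr ⟨hJw, hSD hPR⟩⟩))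
      rw [hDp, mem_filter]
      exact ⟨hmemPI hP hP0 (hNle ((dvd_mul_right P P).trans hPR)), hp, hz.trans hzP⟩
    · refine mem_union_right _ (mem_union_right _ (mem_biUnion.mpr ⟨(P, P'), ?_,
        mem_BIdeals_iff.mpr ⟨hJw, hSD hPR⟩⟩))
      rw [hDpairs, mem_filter, mem_product, hDp, mem_filter, mem_filter]
      refine ⟨⟨⟨hmemPI hP hP0 (hNle ((dvd_mul_right P P').trans hPR)), hp, hz.trans hzP⟩,
        ⟨hmemPI hP' hP'0 (hNle ((dvd_mul_left P' P).trans hPR)), hN ▸ hp, ?_⟩⟩, hne, hN⟩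
      have : (Ideal.absNorm P' : ℝ) = Ideal.absNorm P := by exact_mod_cast hN.symm
      rw [this]; exact hz.trans hzP
  -- counting each piece by (7.7)
  have hpiece : ∀ {D : Ideal (𝓞 K)}, D ≠ ⊥ → (#(BIdeals X η (S * D)) : ℝ) ≤
      C_B * X ^ 3 / Ideal.absNorm S * ((Ideal.absNorm D : ℕ) : ℝ)⁻¹ := by
    intro D hD0
    have hSD0 : S * D ≠ ⊥ := mul_ne_zero hS0 hD0
    have h := hcountB (S * D) hSD0
    rw [countB] at h
    refine h.trans (le_of_eq ?_)
    rw [map_mul, Nat.cast_mul, div_mul_eq_div_div, div_eq_mul_inv]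
  have hmemDnp : ∀ P ∈ Dnp, P ≠ ⊥ := fun P hP => by
    rw [hDnp, mem_filter, hPI, Set.Finite.mem_toFinset] at hP; exact hP.1.2.1
  have hmemDp : ∀ P ∈ Dp, P ≠ ⊥ := fun P hP => by
    rw [hDp, mem_filter, hPI, Set.Finite.mem_toFinset] at hP; exact hP.1.2.1
  have h1 : (#(Dnp.biUnion fun P => BIdeals X η (S * P)) : ℝ) ≤
      C_B * X ^ 3 / Ideal.absNorm S * ∑ P ∈ Dnp, ((Ideal.absNorm P : ℕ) : ℝ)⁻¹ := by
    calc (#(Dnp.biUnion fun P => BIdeals X η (S * P)) : ℝ)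
        ≤ ∑ P ∈ Dnp, (#(BIdeals X η (S * P)) : ℝ) := by exact_mod_cast card_biUnion_le
      _ ≤ ∑ P ∈ Dnp, C_B * X ^ 3 / Ideal.absNorm S * ((Ideal.absNorm P : ℕ) : ℝ)⁻¹ :=
          sum_le_sum fun P hP => hpiece (hmemDnp P hP)
      _ = _ := by rw [mul_sum]
  have h2 : (#(Dp.biUnion fun P => BIdeals X η (S * (P * P))) : ℝ) ≤
      C_B * X ^ 3 / Ideal.absNorm S * ∑ P ∈ Dp, ((Ideal.absNorm P : ℕ) : ℝ)⁻¹ * ((Ideal.absNorm P : ℕ) : ℝ)⁻¹ := by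
    calc (#(Dp.biUnion fun P => BIdeals X η (S * (P * P))) : ℝ)
        ≤ ∑ P ∈ Dp, (#(BIdeals X η (S * (P * P))) : ℝ) := by exact_mod_cast card_biUnion_le
      _ ≤ ∑ P ∈ Dp, C_B * X ^ 3 / Ideal.absNorm S * (((Ideal.absNorm P : ℕ) : ℝ)⁻¹ * ((Ideal.absNorm P : ℕ) : ℝ)⁻¹) :=
          sum_le_sum fun P hP => by
            have h := hpiece (mul_ne_zero (hmemDp P hP) (hmemDp P hP))
            rwa [map_mul, Nat.cast_mul, mul_inv] at h
      _ = _ := by rw [mul_sum]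
  have h3 : (#(Dpairs.biUnion fun x => BIdeals X η (S * (x.1 * x.2))) : ℝ) ≤
      C_B * X ^ 3 / Ideal.absNorm S *
        ∑ x ∈ Dpairs, ((Ideal.absNorm x.1 : ℕ) : ℝ)⁻¹ * ((Ideal.absNorm x.2 : ℕ) : ℝ)⁻¹ := by
    calc (#(Dpairs.biUnion fun x => BIdeals X η (S * (x.1 * x.2))) : ℝ)
        ≤ ∑ x ∈ Dpairs, (#(BIdeals X η (S * (x.1 * x.2))) : ℝ) := by exact_mod_cast card_biUnion_le
      _ ≤ ∑ x ∈ Dpairs, C_B * X ^ 3 / Ideal.absNorm S *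
            (((Ideal.absNorm x.1 : ℕ) : ℝ)⁻¹ * ((Ideal.absNorm x.2 : ℕ) : ℝ)⁻¹) :=
          sum_le_sum fun x hx => by
            rw [hDpairs, mem_filter, mem_product] at hx
            have h := hpiece (mul_ne_zero (hmemDp x.1 hx.1.1) (hmemDp x.2 hx.1.2))
            rwa [map_mul, Nat.cast_mul, mul_inv] at h
      _ = _ := by rw [mul_sum]
  calc (#T : ℝ) ≤ #((Dnp.biUnion fun P => BIdeals X η (S * P)) ∪
        ((Dp.biUnion fun P => BIdeals X η (S * (P * P))) ∪
          (Dpairs.biUnion fun x => BIdeals X η (S * (x.1 * x.2))))) := by exact_mod_cast card_le_card hcover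
    _ ≤ #(Dnp.biUnion fun P => BIdeals X η (S * P)) +
        (#(Dp.biUnion fun P => BIdeals X η (S * (P * P))) +
          #(Dpairs.biUnion fun x => BIdeals X η (S * (x.1 * x.2)))) := by
        exact_mod_cast (card_union_le _ _).trans (Nat.add_le_add_left (card_union_le _ _) _)
    _ ≤ _ := by
        have := add_le_add h1 (add_le_add h2 h3)
        rw [mul_add, mul_add]
        linarith

/-- **The three divisor weights are `≪ X^{−τ/3}`** (`X^τ ≥ 16`): by `sum_inv_absNorm_nonprime_le`
(`≤ 6/(X^τ/2)^{1/3} ≤ 12X^{−τ/3}`) and `sum_inv_absNorm_pair_eq_le` (`≤ 18/(X^τ/2)`, diagonal and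
off-diagonal pairs). [cite: HeathBrownActa2001, §7 p. 45] -/
theorem defect_weights_B_le (hX : 0 < X) (hXτ : 16 ≤ X ^ τ) (PI : Finset (Ideal (𝓞 K)))
    (hPI : ∀ P ∈ PI, P.IsPrime ∧ P ≠ ⊥) :
    ∑ P ∈ PI.filter (fun P => ¬ (Ideal.absNorm P).Prime ∧ X ^ τ ≤ (Ideal.absNorm P : ℝ)),
        ((Ideal.absNorm P : ℕ) : ℝ)⁻¹ ≤ 12 * X ^ (-(τ / 3)) ∧
    ∑ P ∈ PI.filter (fun P => (Ideal.absNorm P).Prime ∧ X ^ τ ≤ (Ideal.absNorm P : ℝ)),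
        ((Ideal.absNorm P : ℕ) : ℝ)⁻¹ * ((Ideal.absNorm P : ℕ) : ℝ)⁻¹ ≤ 36 * X ^ (-τ) ∧
    ∑ x ∈ ((PI.filter (fun P => (Ideal.absNorm P).Prime ∧ X ^ τ ≤ (Ideal.absNorm P : ℝ))) ×ˢ
        (PI.filter (fun P => (Ideal.absNorm P).Prime ∧ X ^ τ ≤ (Ideal.absNorm P : ℝ)))).filter
        (fun x => x.1 ≠ x.2 ∧ Ideal.absNorm x.1 = Ideal.absNorm x.2),
        ((Ideal.absNorm x.1 : ℕ) : ℝ)⁻¹ * ((Ideal.absNorm x.2 : ℕ) : ℝ)⁻¹ ≤ 36 * X ^ (-τ) := by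
  classical
  have hXτ0 : 0 < X ^ τ := by linarith
  set Y : ℝ := X ^ τ / 2 with hY
  have hY8 : 8 ≤ Y := by rw [hY]; linarith
  have hY2 : 2 ≤ Y := by linarith
  have hYlt : ∀ {P : Ideal (𝓞 K)}, X ^ τ ≤ (Ideal.absNorm P : ℝ) → Y < (Ideal.absNorm P : ℝ) :=
    fun h => lt_of_lt_of_le (by rw [hY]; linarith) h
  have hinvY : 18 / Y = 36 * X ^ (-τ) := by
    rw [hY, Real.rpow_neg hX.le]; field_simp; ring
  refine ⟨?_, ?_, ?_⟩
  · have h := sum_inv_absNorm_nonprime_le hY8 (PI.filter (fun P => ¬ (Ideal.absNorm P).Prime ∧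
        X ^ τ ≤ (Ideal.absNorm P : ℝ))) fun P hP => by
      obtain ⟨hP1, hP2⟩ := mem_filter.mp hP
      exact ⟨(hPI P hP1).1, (hPI P hP1).2, hP2.1, hYlt hP2.2⟩
    refine h.trans ?_
    -- `6/(X^τ/2)^{1/3} ≤ 12 X^{-τ/3}`
    have hY3 : X ^ (τ / 3) / 2 ≤ Y ^ (1 / 3 : ℝ) := by
      rw [hY, Real.div_rpow hXτ0.le (by norm_num), ← Real.rpow_mul hX.le,
        show τ * (1 / 3 : ℝ) = τ / 3 by ring]
      have h2 : (2 : ℝ) ^ (1 / 3 : ℝ) ≤ 2 := by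
        calc (2 : ℝ) ^ (1 / 3 : ℝ) ≤ 2 ^ (1 : ℝ) := Real.rpow_le_rpow_of_exponent_le one_le_two (by norm_num)
          _ = 2 := Real.rpow_one 2
      have h0 : 0 < (2 : ℝ) ^ (1 / 3 : ℝ) := by positivity
      have hx0 : 0 ≤ X ^ (τ / 3) := by positivity
      rw [div_le_div_iff₀ two_pos h0]
      nlinarith
    have hτ3 : 0 < X ^ (τ / 3) := Real.rpow_pos_of_pos hX _
    calc 6 / Y ^ (1 / 3 : ℝ) ≤ 6 / (X ^ (τ / 3) / 2) := div_le_div_of_nonneg_left (by norm_num) (by positivity) hY3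
      _ = 12 * X ^ (-(τ / 3)) := by rw [Real.rpow_neg hX.le]; field_simp; ring
  · set Dp := PI.filter (fun P => (Ideal.absNorm P).Prime ∧ X ^ τ ≤ (Ideal.absNorm P : ℝ)) with hDp
    have hinj : Set.InjOn (fun P : Ideal (𝓞 K) => (P, P)) Dp := fun P _ P' _ h => (Prod.ext_iff.mp h).1
    have h := sum_inv_absNorm_pair_eq_le hY2 (Dp.image fun P => (P, P)) fun x hx => by
      obtain ⟨P, hP, rfl⟩ := mem_image.mp hx
      obtain ⟨hP1, hP2⟩ := mem_filter.mp hP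
      exact ⟨(hPI P hP1).1, (hPI P hP1).2, (hPI P hP1).1, (hPI P hP1).2, rfl, hYlt hP2.2⟩
    rw [sum_image hinj] at h
    rw [← hinvY]; exact h
  · have h := sum_inv_absNorm_pair_eq_le hY2 (((PI.filter (fun P => (Ideal.absNorm P).Prime ∧
        X ^ τ ≤ (Ideal.absNorm P : ℝ))) ×ˢ (PI.filter (fun P => (Ideal.absNorm P).Prime ∧
        X ^ τ ≤ (Ideal.absNorm P : ℝ)))).filter
        (fun x => x.1 ≠ x.2 ∧ Ideal.absNorm x.1 = Ideal.absNorm x.2)) fun x hx => by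
      rw [mem_filter, mem_product, mem_filter, mem_filter] at hx
      obtain ⟨⟨⟨h1, -, h1'⟩, ⟨h2, -, -⟩⟩, -, hN⟩ := hx
      exact ⟨(hPI _ h1).1, (hPI _ h1).2, (hPI _ h2).1, (hPI _ h2).2, hN, hYlt h1'⟩
    rw [← hinvY]; exact h


/-! ### Sums over chain tuples: `∑_b N(P_1⋯P_{n+1})^{-1} ≤ ê_{n+1}` -/

/-- The chain tuples `b = (𝐦, (P_j))` are determined by the set `{P_1, …, P_{n+1}}`. [folklore] -/
theorem image_snd_injOn (hX : 1 < X) (hτ : 0 < τ) (hτ1 : τ ≤ 1) (n : ℕ) :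
    Set.InjOn (fun b : (Σ _ : Fin (n + 1) → ℕ, Fin (n + 1) → Ideal (𝓞 K)) => univ.image b.2)
      ((mIndexU τ n).sigma (fun m => Fintype.piFinset fun i => Jprimes X τ (m i))) := by
  classical
  intro b hb b' hb' heq
  simp only at heq
  obtain ⟨hm, hP⟩ := mem_sigma.mp hb
  obtain ⟨hm', hP'⟩ := mem_sigma.mp hb'
  obtain ⟨-, -, -, hSA, -⟩ := U_index_props hX hτ hτ1 hm hP
  obtain ⟨-, -, -, hSA', -⟩ := U_index_props hX hτ hτ1 hm' hP'
  have hinjb : Set.InjOn b.2 (univ : Finset (Fin (n + 1))) :=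
    fun i _ j _ h => hSA.injective (congrArg Ideal.absNorm h)
  have hinjb' : Set.InjOn b'.2 (univ : Finset (Fin (n + 1))) :=
    fun i _ j _ h => hSA'.injective (congrArg Ideal.absNorm h)
  have hprod : ∏ j, b.2 j = ∏ j, b'.2 j := by
    rw [← prod_image (f := fun P => P) hinjb, ← prod_image (f := fun P => P) hinjb', heq]
  have hanti : StrictAnti b.1 := ((mem_mIndexU_iff hτ).mp hm).1.1
  have hanti' : StrictAnti b'.1 := ((mem_mIndexU_iff hτ).mp hm').1.1
  obtain ⟨h2, h1⟩ := tuple_eq_of_prod_eq hX hτ hanti hanti' hP hP' hprod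
  exact Sigma.ext h1 (heq_of_eq h2)

/-- **`∑_b N(P_1⋯P_{n+1})^{-1} ≤ ê_{n+1}(𝒫₀)`**, the elementary symmetric sum of `N(P)^{-1}` over the
prime ideals `X^τ ≤ N(P) < X^{1−τ}` (re-index by the set `{P_j}`). [cite: HeathBrownActa2001, §7 p. 45] -/
theorem sum_inv_absNorm_tuples_le (hX : 1 < X) (hτ : 0 < τ) (hτ1 : τ ≤ 1) (n : ℕ) :
    ∑ b ∈ (mIndexU τ n).sigma (fun m => Fintype.piFinset fun i => Jprimes X τ (m i)),
        ((Ideal.absNorm (∏ j, b.2 j) : ℕ) : ℝ)⁻¹ ≤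
      ∑ s ∈ (smallPrimes X τ).powersetCard (n + 1), ∏ P ∈ s, ((Ideal.absNorm P : ℕ) : ℝ)⁻¹ := by
  classical
  set A := (mIndexU τ n).sigma (fun m => Fintype.piFinset fun i => Jprimes X τ (m i)) with hA
  have hprops : ∀ b ∈ A, Set.InjOn b.2 (univ : Finset (Fin (n + 1))) ∧ ∀ j, b.2 j ∈ smallPrimes X τ := by
    intro b hb
    obtain ⟨hm, hP⟩ := mem_sigma.mp hb
    obtain ⟨-, -, hsmall, hSA, -⟩ := U_index_props hX hτ hτ1 hm hP
    exact ⟨fun i _ j _ h => hSA.injective (congrArg Ideal.absNorm h), hsmall⟩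
  have key : ∀ b ∈ A, ((Ideal.absNorm (∏ j, b.2 j) : ℕ) : ℝ)⁻¹ =
      ∏ P ∈ univ.image b.2, ((Ideal.absNorm P : ℕ) : ℝ)⁻¹ := by
    intro b hb
    rw [prod_image (hprops b hb).1, map_prod, Nat.cast_prod, prod_inv_distrib]
  rw [sum_congr rfl key, ← sum_image (f := fun s => ∏ P ∈ s, ((Ideal.absNorm P : ℕ) : ℝ)⁻¹)
    (image_snd_injOn hX hτ hτ1 n)]
  refine sum_le_sum_of_subset_of_nonneg (fun s hs => ?_) fun _ _ _ => prod_nonneg fun _ _ => by positivity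
  obtain ⟨b, hb, rfl⟩ := mem_image.mp hs
  rw [mem_powersetCard]
  refine ⟨fun P hP => ?_, ?_⟩
  · obtain ⟨j, -, rfl⟩ := mem_image.mp hP
    exact (hprops b hb).2 j
  · rw [card_image_of_injOn (hprops b hb).1, card_univ, Fintype.card_fin]

open scoped Classical in
/-- **(E4) for `ℬ^(K)`**: the square-free defect of `Û^{(𝐦,n)}(ℬ)` is at most
`C_B X³ · W₄ · ê_{n+1}(𝒫₀)` (`defect_count_B_le` at each `S = P_1⋯P_{n+1}`, summed by
`sum_inv_absNorm_tuples_le`). [cite: HeathBrownActa2001, §7 (7.7), p. 45] -/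
theorem E4_B_le (hX : 1 < X) (hτ : 0 < τ) (hτ1 : τ ≤ 1) (hη1 : η ≤ 1) {C_B : ℝ} (hCB : 0 ≤ C_B)
    (hcountB : ∀ R : Ideal (𝓞 K), R ≠ ⊥ → (countB X η R : ℝ) ≤ C_B * X ^ 3 / Ideal.absNorm R)
    {W₄ : ℝ}
    (hW₄ : ∑ P ∈ (Literature.NumberTheory.LFunctions.NumberField.finite_primeIdealsLE K (6 * X ^ 3)).toFinset.filter
            (fun P => ¬ (Ideal.absNorm P).Prime ∧ X ^ τ ≤ (Ideal.absNorm P : ℝ)),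
            ((Ideal.absNorm P : ℕ) : ℝ)⁻¹ +
         ∑ P ∈ (Literature.NumberTheory.LFunctions.NumberField.finite_primeIdealsLE K (6 * X ^ 3)).toFinset.filter
            (fun P => (Ideal.absNorm P).Prime ∧ X ^ τ ≤ (Ideal.absNorm P : ℝ)),
            ((Ideal.absNorm P : ℕ) : ℝ)⁻¹ * ((Ideal.absNorm P : ℕ) : ℝ)⁻¹ +
         ∑ x ∈ ((Literature.NumberTheory.LFunctions.NumberField.finite_primeIdealsLE K (6 * X ^ 3)).toFinset.filter
              (fun P => (Ideal.absNorm P).Prime ∧ X ^ τ ≤ (Ideal.absNorm P : ℝ)) ×ˢ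
            (Literature.NumberTheory.LFunctions.NumberField.finite_primeIdealsLE K (6 * X ^ 3)).toFinset.filter
              (fun P => (Ideal.absNorm P).Prime ∧ X ^ τ ≤ (Ideal.absNorm P : ℝ))).filter
            (fun x => x.1 ≠ x.2 ∧ Ideal.absNorm x.1 = Ideal.absNorm x.2),
            ((Ideal.absNorm x.1 : ℕ) : ℝ)⁻¹ * ((Ideal.absNorm x.2 : ℕ) : ℝ)⁻¹ ≤ W₄) (n : ℕ) :
    ∑ b ∈ (mIndexU τ n).sigma (fun m => Fintype.piFinset fun i => Jprimes X τ (m i)),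
        (#{J ∈ normWindow X η | (∏ j, b.2 j) ∣ J ∧
            IsRough (X ^ ((b.1 (Fin.last n) : ℝ) * hbXi τ)) J ∧
            ¬ Squarefree (Ideal.absNorm J / Ideal.absNorm (∏ j, b.2 j))} : ℝ) ≤
      C_B * X ^ 3 * W₄ *
        ∑ s ∈ (smallPrimes X τ).powersetCard (n + 1), ∏ P ∈ s, ((Ideal.absNorm P : ℕ) : ℝ)⁻¹ := by
  classical
  have hX0 : 0 < X := by linarith
  have hW₄0 : 0 ≤ W₄ := le_trans (by positivity) hW₄
  refine le_trans (sum_le_sum fun b hb => ?_)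
    (le_trans (le_of_eq (mul_sum _ _ _).symm)
      (mul_le_mul_of_nonneg_left (sum_inv_absNorm_tuples_le hX hτ hτ1 n) (by positivity)))
  obtain ⟨hm, hP⟩ := mem_sigma.mp hb
  obtain ⟨-, hPj, -, -, -, -, -, -, -, hzτ⟩ := U_index_props hX hτ hτ1 hm hP
  have hS0 : (∏ j, b.2 j) ≠ ⊥ := Finset.prod_ne_zero_iff.mpr fun j _ => (hPj j).2.1
  have h := defect_count_B_le hX0 hη1 hS0 hzτ hcountB
  refine h.trans ?_
  rw [div_eq_mul_inv]
  have hN0 : (0 : ℝ) ≤ ((Ideal.absNorm (∏ j, b.2 j) : ℕ) : ℝ)⁻¹ := by positivity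
  calc C_B * X ^ 3 * ((Ideal.absNorm (∏ j, b.2 j) : ℕ) : ℝ)⁻¹ * _
      ≤ C_B * X ^ 3 * ((Ideal.absNorm (∏ j, b.2 j) : ℕ) : ℝ)⁻¹ * W₄ :=
        mul_le_mul_of_nonneg_left hW₄ (by positivity)
    _ = C_B * X ^ 3 * W₄ * ((Ideal.absNorm (∏ j, b.2 j) : ℕ) : ℝ)⁻¹ := by ring

open scoped Classical in
/-- **(E3ii) for `ℬ^(K)`**: the Buchstab primes `Q ≺ P_{n+1}` of degree `≥ 2` or with
`N(Q) = N(P_j)` contribute at most `C_B X³ (W₁ + 3(n+1)X^{−τ}) ê_{n+1}(𝒫₀)` ((7.7); at most `3`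
prime ideals share a norm). [cite: HeathBrownActa2001, §7 (7.7), p. 44] -/
theorem E3ii_B_le (hX : 1 < X) (hτ : 0 < τ) (hτ1 : τ ≤ 1) {C_B : ℝ} (hCB : 0 ≤ C_B)
    (hcountB : ∀ R : Ideal (𝓞 K), R ≠ ⊥ → (countB X η R : ℝ) ≤ C_B * X ^ 3 / Ideal.absNorm R)
    {W₁ : ℝ}
    (hW₁ : ∑ P ∈ (Literature.NumberTheory.LFunctions.NumberField.finite_primeIdealsLE K (6 * X ^ 3)).toFinset.filter
            (fun P => ¬ (Ideal.absNorm P).Prime ∧ X ^ τ ≤ (Ideal.absNorm P : ℝ)),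
            ((Ideal.absNorm P : ℕ) : ℝ)⁻¹ ≤ W₁) (n : ℕ) :
    ∑ b ∈ (mIndexU τ n).sigma (fun m => Fintype.piFinset fun i => Jprimes X τ (m i)),
      ∑ Q ∈ ((idealsLE (Ideal.absNorm (b.2 (Fin.last n)))).filter
          (fun Q => Q.IsPrime ∧ Q ≠ ⊥ ∧ X ^ ((b.1 (Fin.last n) : ℝ) * hbXi τ) ≤ (Ideal.absNorm Q : ℝ) ∧
            PrimeLT Q (b.2 (Fin.last n)))).filter
          (fun Q => ¬ ((Ideal.absNorm Q).Prime ∧ ∀ j, Ideal.absNorm Q ≠ Ideal.absNorm (b.2 j))),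
        (famCount (normWindow X η) (fun J => J) (Q * ∏ j, b.2 j) : ℝ) ≤
      C_B * X ^ 3 * (W₁ + 3 * ((n : ℝ) + 1) * (X ^ τ)⁻¹) *
        ∑ s ∈ (smallPrimes X τ).powersetCard (n + 1), ∏ P ∈ s, ((Ideal.absNorm P : ℕ) : ℝ)⁻¹ := by
  classical
  have hX0 : 0 < X := by linarith
  have hXτ0 : 0 < X ^ τ := Real.rpow_pos_of_pos hX0 τ
  have hW₁0 : 0 ≤ W₁ := le_trans (sum_nonneg fun _ _ => by positivity) hW₁
  refine le_trans (sum_le_sum fun b hb => ?_)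
    (le_trans (le_of_eq (mul_sum _ _ _).symm)
      (mul_le_mul_of_nonneg_left (sum_inv_absNorm_tuples_le hX hτ hτ1 n) (by positivity)))
  obtain ⟨hm, hP⟩ := mem_sigma.mp hb
  obtain ⟨-, hPj, hsmall, -, -, -, -, -, -, hzτ⟩ := U_index_props hX hτ hτ1 hm hP
  set S := ∏ j, b.2 j with hS
  have hS0 : S ≠ ⊥ := by rw [hS]; exact Finset.prod_ne_zero_iff.mpr fun j _ => (hPj j).2.1
  set Bset := (idealsLE (Ideal.absNorm (b.2 (Fin.last n)))).filter
    (fun Q => Q.IsPrime ∧ Q ≠ ⊥ ∧ X ^ ((b.1 (Fin.last n) : ℝ) * hbXi τ) ≤ (Ideal.absNorm Q : ℝ) ∧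
      PrimeLT Q (b.2 (Fin.last n))) with hBset
  set bad := fun Q : Ideal (𝓞 K) => ¬ ((Ideal.absNorm Q).Prime ∧ ∀ j, Ideal.absNorm Q ≠ Ideal.absNorm (b.2 j))
    with hbad
  change ∑ Q ∈ Bset.filter bad, (famCount (normWindow X η) (fun J => J) (Q * S) : ℝ) ≤
    C_B * X ^ 3 * (W₁ + 3 * ((n : ℝ) + 1) * (X ^ τ)⁻¹) * ((Ideal.absNorm S : ℕ) : ℝ)⁻¹
  have hBmem : ∀ Q ∈ Bset, Q.IsPrime ∧ Q ≠ ⊥ ∧ X ^ τ ≤ (Ideal.absNorm Q : ℝ) ∧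
      (Ideal.absNorm Q : ℝ) ≤ 6 * X ^ 3 := by
    intro Q hQ
    rw [hBset, mem_filter] at hQ
    obtain ⟨-, hQp, hQ0, hQz, hQlt⟩ := hQ
    refine ⟨hQp, hQ0, hzτ.trans hQz, ?_⟩
    have h1 : Ideal.absNorm Q ≤ Ideal.absNorm (b.2 (Fin.last n)) := hQlt.absNorm_le
    have h2 := (mem_smallPrimes_iff.mp (hsmall (Fin.last n))).2.2.2
    have h3 : X ^ (1 - τ) ≤ 6 * X ^ 3 := by
      calc X ^ (1 - τ) ≤ X ^ (3 : ℝ) := Real.rpow_le_rpow_of_exponent_le hX.le (by linarith)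
        _ = X ^ 3 := by rw [show (3 : ℝ) = ((3 : ℕ) : ℝ) by norm_num, Real.rpow_natCast]
        _ ≤ 6 * X ^ 3 := by nlinarith [pow_pos hX0 3]
    calc (Ideal.absNorm Q : ℝ) ≤ Ideal.absNorm (b.2 (Fin.last n)) := by exact_mod_cast h1
      _ ≤ 6 * X ^ 3 := by linarith
  -- each term by (7.7)
  have hterm : ∀ Q ∈ Bset.filter bad, (famCount (normWindow X η) (fun J => J) (Q * S) : ℝ) ≤
      C_B * X ^ 3 * ((Ideal.absNorm S : ℕ) : ℝ)⁻¹ * ((Ideal.absNorm Q : ℕ) : ℝ)⁻¹ := by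
    intro Q hQ
    obtain ⟨hQB, -⟩ := mem_filter.mp hQ
    have hQ0 := (hBmem Q hQB).2.1
    rw [famCount_normWindow]
    refine (hcountB (Q * S) (mul_ne_zero hQ0 hS0)).trans (le_of_eq ?_)
    rw [map_mul, Nat.cast_mul]
    field_simp
  refine (sum_le_sum hterm).trans ?_
  rw [← mul_sum]
  have hc0 : 0 ≤ C_B * X ^ 3 * ((Ideal.absNorm S : ℕ) : ℝ)⁻¹ := by positivity
  calc C_B * X ^ 3 * ((Ideal.absNorm S : ℕ) : ℝ)⁻¹ * ∑ Q ∈ Bset.filter bad, ((Ideal.absNorm Q : ℕ) : ℝ)⁻¹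
      ≤ C_B * X ^ 3 * ((Ideal.absNorm S : ℕ) : ℝ)⁻¹ * (W₁ + 3 * ((n : ℝ) + 1) * (X ^ τ)⁻¹) := by
        refine mul_le_mul_of_nonneg_left ?_ hc0
        -- split the bad primes
        have hsub : Bset.filter bad ⊆ Bset.filter (fun Q => ¬ (Ideal.absNorm Q).Prime) ∪
            (univ : Finset (Fin (n + 1))).biUnion (fun j => Bset.filter
              (fun Q => Q.IsPrime ∧ Q ≠ ⊥ ∧ Ideal.absNorm Q = Ideal.absNorm (b.2 j))) := by
          intro Q hQ
          obtain ⟨hQB, hQbad⟩ := mem_filter.mp hQ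
          by_cases hpr : (Ideal.absNorm Q).Prime
          · have : ∃ j, Ideal.absNorm Q = Ideal.absNorm (b.2 j) := by
              by_contra h
              push Not at h
              exact hQbad ⟨hpr, h⟩
            obtain ⟨j, hj⟩ := this
            exact mem_union_right _ (mem_biUnion.mpr ⟨j, mem_univ _,
              mem_filter.mpr ⟨hQB, (hBmem Q hQB).1, (hBmem Q hQB).2.1, hj⟩⟩)
          · exact mem_union_left _ (mem_filter.mpr ⟨hQB, hpr⟩)
        refine (sum_le_sum_of_subset_of_nonneg hsub fun _ _ _ => by positivity).trans ?_
        refine (sum_union_le_add _ _ fun _ => by positivity).trans (add_le_add ?_ ?_)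
        · refine le_trans (sum_le_sum_of_subset_of_nonneg (fun Q hQ => ?_) fun _ _ _ => by positivity) hW₁
          obtain ⟨hQB, hnp⟩ := mem_filter.mp hQ
          obtain ⟨h1, h2, h3, h4⟩ := hBmem Q hQB
          rw [mem_filter, Set.Finite.mem_toFinset]
          exact ⟨⟨h1, h2, h4⟩, hnp, h3⟩
        · -- at most `3(n+1)` primes, each of norm `≥ X^τ`
          set F := (univ : Finset (Fin (n + 1))).biUnion (fun j => Bset.filter
            (fun Q => Q.IsPrime ∧ Q ≠ ⊥ ∧ Ideal.absNorm Q = Ideal.absNorm (b.2 j))) with hF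
          have hcard : #F ≤ (n + 1) * 3 := by
            calc #F ≤ ∑ j : Fin (n + 1), #(Bset.filter
                  (fun Q => Q.IsPrime ∧ Q ≠ ⊥ ∧ Ideal.absNorm Q = Ideal.absNorm (b.2 j))) := card_biUnion_le
              _ ≤ ∑ _j : Fin (n + 1), 3 := sum_le_sum fun j _ => card_filter_isPrime_absNorm_eq_le_three _ _
              _ = (n + 1) * 3 := by rw [sum_const, card_univ, Fintype.card_fin, smul_eq_mul]
          have hle : ∀ Q ∈ F, ((Ideal.absNorm Q : ℕ) : ℝ)⁻¹ ≤ (X ^ τ)⁻¹ := by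
            intro Q hQ
            rw [hF, mem_biUnion] at hQ
            obtain ⟨j, -, hQj⟩ := hQ
            obtain ⟨hQB, -⟩ := mem_filter.mp hQj
            exact inv_anti₀ hXτ0 (hBmem Q hQB).2.2.1
          calc ∑ Q ∈ F, ((Ideal.absNorm Q : ℕ) : ℝ)⁻¹ ≤ ∑ _Q ∈ F, (X ^ τ)⁻¹ := sum_le_sum hle
            _ = #F * (X ^ τ)⁻¹ := by rw [sum_const, nsmul_eq_mul]
            _ ≤ ((n + 1) * 3 : ℕ) * (X ^ τ)⁻¹ := by
                exact mul_le_mul_of_nonneg_right (by exact_mod_cast hcard) (by positivity)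
            _ = 3 * ((n : ℝ) + 1) * (X ^ τ)⁻¹ := by push_cast; ring
    _ = C_B * X ^ 3 * (W₁ + 3 * ((n : ℝ) + 1) * (X ^ τ)⁻¹) * ((Ideal.absNorm S : ℕ) : ℝ)⁻¹ := by ring

/-! ### (E1) for `ℬ^(K)`: non-good chain indices -/

/-- The chain index `(s, P_{n+1})` is determined by the set `{P_1, …, P_{n+1}}` (`P_{n+1}` is its
`≺`-least member). [folklore] -/
theorem insert_injOn_Upairs (n : ℕ) :
    Set.InjOn (fun t : Finset (Ideal (𝓞 K)) × Ideal (𝓞 K) => insert t.2 t.1) (Upairs X τ n) := by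
  classical
  intro t ht t' ht' heq
  simp only at heq
  have hlt := (mem_Upairs_iff.mp ht).2.2.1
  have hlt' := (mem_Upairs_iff.mp ht').2.2.1
  have h2 : t.2 = t'.2 := by
    have ha : t'.2 ∈ insert t.2 t.1 := by rw [heq]; exact mem_insert_self _ _
    have hb : t.2 ∈ insert t'.2 t'.1 := by rw [← heq]; exact mem_insert_self _ _
    rcases mem_insert.mp ha with h | h
    · exact h.symm
    · rcases mem_insert.mp hb with h' | h'
      · exact h'
      · exact absurd ((hlt _ h).trans (hlt' _ h')) (primeLT_irrefl _)
  have h1 : t.1 = t'.1 := by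
    rw [← erase_insert (snd_notMem_fst ht), heq, h2, erase_insert (snd_notMem_fst ht')]
  exact Prod.ext h1 h2

open scoped Classical in
/-- **(E1) for `ℬ^(K)`** ((7.7) and "fix the offending prime(s)", p. 43): the non-good chain indices
contribute at most `C_B X³ (W₁' ê_n + W₂ ê_{n−1})`, where `W₁' = ∑_{P ∈ 𝒫₀, deg ≥ 2} N(P)^{-1}`,
`W₂ = ∑_{P ≠ P' ∈ 𝒫₀, N(P) = N(P')} N(P)^{-1}N(P')^{-1}` and `ê_j` is the elementary symmetric sum of
`N(P)^{-1}` over `𝒫₀` (`sum_sel_le`, `sum_sel₂_le`). [cite: HeathBrownActa2001, §7 (7.7), p. 43] -/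
theorem E1_B_le (hX : 0 ≤ X) {C_B : ℝ} (hCB : 0 ≤ C_B)
    (hcountB : ∀ R : Ideal (𝓞 K), R ≠ ⊥ → (countB X η R : ℝ) ≤ C_B * X ^ 3 / Ideal.absNorm R)
    {W₁' W₂ : ℝ}
    (hW₁' : ∑ P ∈ (smallPrimes X τ).filter (fun P => ¬ (Ideal.absNorm P).Prime),
        ((Ideal.absNorm P : ℕ) : ℝ)⁻¹ ≤ W₁')
    (hW₂ : ∑ x ∈ (smallPrimes X τ ×ˢ smallPrimes X τ).filter
        (fun x => x.1 ≠ x.2 ∧ Ideal.absNorm x.1 = Ideal.absNorm x.2),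
        ((Ideal.absNorm x.1 : ℕ) : ℝ)⁻¹ * ((Ideal.absNorm x.2 : ℕ) : ℝ)⁻¹ ≤ W₂)
    (hn : 1 ≤ n) :
    ∑ t ∈ (Upairs X τ n).filter (fun t => ¬ UGood t),
        (famCount (normWindow X η) (fun J => J) (uIdeal t) : ℝ) ≤
      C_B * X ^ 3 *
        (W₁' * ∑ s ∈ (smallPrimes X τ).powersetCard n, ∏ P ∈ s, ((Ideal.absNorm P : ℕ) : ℝ)⁻¹ +
          W₂ * ∑ s ∈ (smallPrimes X τ).powersetCard (n - 1), ∏ P ∈ s, ((Ideal.absNorm P : ℕ) : ℝ)⁻¹) := by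
  classical
  obtain ⟨k, rfl⟩ := Nat.exists_eq_add_of_le' hn
  simp only [Nat.add_sub_cancel]
  set sP := smallPrimes X τ with hsP
  set w : Ideal (𝓞 K) → ℝ := fun P => ((Ideal.absNorm P : ℕ) : ℝ)⁻¹ with hw
  have hw0 : ∀ P ∈ sP, 0 ≤ w P := fun P _ => by simp only [hw]; positivity
  have hw0' : ∀ P, 0 ≤ w P := fun P => by simp only [hw]; positivity
  set σf : Finset (Ideal (𝓞 K)) × Ideal (𝓞 K) → Finset (Ideal (𝓞 K)) := fun t => insert t.2 t.1 with hσf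
  -- chain facts
  have hfacts : ∀ t ∈ Upairs X τ (k + 1), t.2 ∉ t.1 ∧ σf t ⊆ sP ∧ #(σf t) = k + 2 ∧ uIdeal t ≠ ⊥ := by
    intro t ht
    have hmem := mem_Upairs_iff.mp ht
    obtain ⟨hsub, hcard, -⟩ := mem_chains_iff.mp hmem.1
    have h2 := snd_notMem_fst ht
    refine ⟨h2, ?_, ?_, ?_⟩
    · intro P hP
      rcases mem_insert.mp hP with rfl | hP
      · exact hmem.2.1
      · exact hsub hP
    · simp only [hσf]; rw [card_insert_of_notMem h2, hcard]
    · rw [uIdeal_eq_prod_insert h2]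
      refine Finset.prod_ne_zero_iff.mpr fun P hP => ?_
      rcases mem_insert.mp hP with rfl | hP
      · exact (mem_smallPrimes_iff.mp hmem.2.1).2.1
      · exact (mem_smallPrimes_iff.mp (hsub hP)).2.1
  -- step 1: (7.7) and the product formula
  have hstep1 : ∀ t ∈ (Upairs X τ (k + 1)).filter (fun t => ¬ UGood t),
      (famCount (normWindow X η) (fun J => J) (uIdeal t) : ℝ) ≤ C_B * X ^ 3 * ∏ P ∈ σf t, w P := by
    intro t ht
    obtain ⟨htU, -⟩ := mem_filter.mp ht
    obtain ⟨h2, -, -, h0⟩ := hfacts t htU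
    rw [famCount_normWindow]
    refine (hcountB _ h0).trans (le_of_eq ?_)
    rw [uIdeal_eq_prod_insert h2, map_prod, Nat.cast_prod, div_eq_mul_inv, ← prod_inv_distrib]
  refine (sum_le_sum hstep1).trans ?_
  rw [← mul_sum]
  refine mul_le_mul_of_nonneg_left ?_ (by positivity)
  -- step 2: split into the two classes
  set T₁ := (Upairs X τ (k + 1)).filter (fun t => ∃ P ∈ σf t, ¬ (Ideal.absNorm P).Prime) with hT₁
  set T₂ := (Upairs X τ (k + 1)).filter
    (fun t => ∃ P ∈ σf t, ∃ P' ∈ σf t, P ≠ P' ∧ Ideal.absNorm P = Ideal.absNorm P') with hT₂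
  have hsplit : (Upairs X τ (k + 1)).filter (fun t => ¬ UGood t) ⊆ T₁ ∪ T₂ := by
    intro t ht
    obtain ⟨htU, hbad⟩ := mem_filter.mp ht
    by_cases h1 : ∀ P ∈ σf t, (Ideal.absNorm P).Prime
    · have h2 : ¬ Set.InjOn Ideal.absNorm ((insert t.2 t.1 : Finset (Ideal (𝓞 K))) : Set (Ideal (𝓞 K))) :=
        fun hinj => hbad ⟨h1, hinj⟩
      simp only [Set.InjOn, not_forall, mem_coe, exists_prop] at h2
      obtain ⟨P, hP, P', hP', hN, hne⟩ := h2
      exact mem_union_right _ (mem_filter.mpr ⟨htU, P, hP, P', hP', hne, hN⟩)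
    · push Not at h1
      exact mem_union_left _ (mem_filter.mpr ⟨htU, h1⟩)
  refine (sum_le_sum_of_subset_of_nonneg hsplit fun _ _ _ => prod_nonneg fun P _ => hw0' P).trans ?_
  refine (sum_union_le_add _ _ fun _ => prod_nonneg fun P _ => hw0' P).trans (add_le_add ?_ ?_)
  · -- class (i): a member of degree `≥ 2`
    have hinj : Set.InjOn σf T₁ := fun t ht t' ht' h =>
      insert_injOn_Upairs (k + 1) (mem_filter.mp ht).1 (mem_filter.mp ht').1 h
    rw [← sum_image (f := fun s => ∏ P ∈ s, w P) hinj]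
    set sel : Finset (Ideal (𝓞 K)) → Ideal (𝓞 K) := fun σ =>
      if h : ∃ P ∈ σ, ¬ (Ideal.absNorm P).Prime then Classical.choose h else ⊥ with hsel
    have hsel_spec : ∀ σ ∈ T₁.image σf, sel σ ∈ σ ∧ ¬ (Ideal.absNorm (sel σ)).Prime := by
      intro σ hσ
      obtain ⟨t, ht, rfl⟩ := mem_image.mp hσ
      have h : ∃ P ∈ σf t, ¬ (Ideal.absNorm P).Prime := (mem_filter.mp ht).2
      simp only [hsel, dif_pos h]
      exact Classical.choose_spec h
    have hA : T₁.image σf ⊆ sP.powersetCard (k + 1 + 1) := by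
      intro σ hσ
      obtain ⟨t, ht, rfl⟩ := mem_image.mp hσ
      obtain ⟨-, hsub, hcard, -⟩ := hfacts t (mem_filter.mp ht).1
      exact mem_powersetCard.mpr ⟨hsub, hcard⟩
    refine sum_sel_le sP w hw0 (k + 1) (T₁.image σf) hA sel (fun σ hσ => (hsel_spec σ hσ).1)
      (fun _ P => ¬ (Ideal.absNorm P).Prime) (fun σ hσ => (hsel_spec σ hσ).2) fun σ' _ => ?_
    exact (sum_le_sum_of_subset_of_nonneg (fun P hP => by
      obtain ⟨h1, h2⟩ := mem_filter.mp hP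
      exact mem_filter.mpr ⟨h1, h2.2⟩) fun P hP _ => hw0 P (mem_filter.mp hP).1).trans hW₁'
  · -- class (ii): two members of the same norm
    have hinj : Set.InjOn σf T₂ := fun t ht t' ht' h =>
      insert_injOn_Upairs (k + 1) (mem_filter.mp ht).1 (mem_filter.mp ht').1 h
    rw [← sum_image (f := fun s => ∏ P ∈ s, w P) hinj]
    set sel₁ : Finset (Ideal (𝓞 K)) → Ideal (𝓞 K) := fun σ =>
      if h : ∃ P ∈ σ, ∃ P' ∈ σ, P ≠ P' ∧ Ideal.absNorm P = Ideal.absNorm P' then Classical.choose h else ⊥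
      with hsel₁
    set sel₂ : Finset (Ideal (𝓞 K)) → Ideal (𝓞 K) := fun σ =>
      if h : ∃ P ∈ σ, ∃ P' ∈ σ, P ≠ P' ∧ Ideal.absNorm P = Ideal.absNorm P' then
        Classical.choose (Classical.choose_spec h).2 else ⊥ with hsel₂
    have hspec : ∀ σ ∈ T₂.image σf, sel₁ σ ∈ σ ∧ sel₂ σ ∈ σ ∧ sel₁ σ ≠ sel₂ σ ∧
        Ideal.absNorm (sel₁ σ) = Ideal.absNorm (sel₂ σ) := by
      intro σ hσ
      obtain ⟨t, ht, rfl⟩ := mem_image.mp hσ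
      have h : ∃ P ∈ σf t, ∃ P' ∈ σf t, P ≠ P' ∧ Ideal.absNorm P = Ideal.absNorm P' := (mem_filter.mp ht).2
      simp only [hsel₁, hsel₂, dif_pos h]
      have h1 := Classical.choose_spec h
      have h2 := Classical.choose_spec h1.2
      exact ⟨h1.1, h2.1, h2.2.1, h2.2.2⟩
    have hA : T₂.image σf ⊆ sP.powersetCard (k + 2) := by
      intro σ hσ
      obtain ⟨t, ht, rfl⟩ := mem_image.mp hσ
      obtain ⟨-, hsub, hcard, -⟩ := hfacts t (mem_filter.mp ht).1
      exact mem_powersetCard.mpr ⟨hsub, hcard⟩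
    exact sum_sel₂_le sP w hw0 k (T₂.image σf) hA sel₁ sel₂ (fun σ hσ => (hspec σ hσ).1)
      (fun σ hσ => (hspec σ hσ).2.1) (fun σ hσ => (hspec σ hσ).2.2.1)
      (fun P P' => Ideal.absNorm P = Ideal.absNorm P') (fun σ hσ => (hspec σ hσ).2.2.2) hW₂

/-! ### Bookkeeping: the weights of `𝒫₀`, the sums `ê_j`, and the sum over `n` -/

/-- `∑_{1≤n≤N} (a ê_n + b ê_{n−1} + (c + d(n+1)) ê_{n+1}) ≤ (a + b + c) e^{Λ'} + d Λ' e^{Λ'}` for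
`ê_j ≤ Λ'^j/j!`. [folklore] -/
theorem sum_ehat_le {Λ' a b c d : ℝ} (hΛ : 0 ≤ Λ') (ha : 0 ≤ a) (hb : 0 ≤ b) (hc : 0 ≤ c)
    (hd : 0 ≤ d) (e : ℕ → ℝ) (he0 : ∀ j, 0 ≤ e j) (he : ∀ j, e j ≤ Λ' ^ j / j.factorial) (N : ℕ) :
    ∑ n ∈ Icc 1 N, (a * e n + b * e (n - 1) + (c + d * ((n : ℝ) + 1)) * e (n + 1)) ≤
      (a + b + c) * Real.exp Λ' + d * (Λ' * Real.exp Λ') := by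
  have hexp := Real.sum_le_exp_of_nonneg hΛ
  have hf : ∀ j, 0 ≤ Λ' ^ j / (j.factorial : ℝ) := fun j => by positivity
  have hsub : Icc 1 N ⊆ range (N + 1) := fun n hn => by
    rw [mem_Icc] at hn; rw [mem_range]; omega
  -- the four sums
  have S1 : ∑ n ∈ Icc 1 N, e n ≤ Real.exp Λ' :=
    calc ∑ n ∈ Icc 1 N, e n ≤ ∑ n ∈ range (N + 1), e n := sum_le_sum_of_subset_of_nonneg hsub fun n _ _ => he0 n
      _ ≤ ∑ n ∈ range (N + 1), Λ' ^ n / n.factorial := sum_le_sum fun n _ => he n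
      _ ≤ Real.exp Λ' := hexp _
  have S2 : ∑ n ∈ Icc 1 N, e (n - 1) ≤ Real.exp Λ' := by
    have hre : ∑ n ∈ Icc 1 N, e (n - 1) = ∑ m ∈ range N, e m := by
      have : Icc 1 N = (range N).map ⟨fun m => m + 1, fun a b h => by simpa using h⟩ := by
        ext n; simp only [mem_Icc, Finset.mem_map, mem_range, Function.Embedding.coeFn_mk]
        constructor
        · intro h; exact ⟨n - 1, by omega, by omega⟩
        · rintro ⟨m, hm, rfl⟩; omega
      rw [this, sum_map]
      rfl
    rw [hre]
    exact (sum_le_sum fun n _ => he n).trans (hexp _)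
  have S3 : ∑ n ∈ Icc 1 N, e (n + 1) ≤ Real.exp Λ' := by
    calc ∑ n ∈ Icc 1 N, e (n + 1) ≤ ∑ n ∈ range (N + 1), e (n + 1) :=
          sum_le_sum_of_subset_of_nonneg hsub fun n _ _ => he0 _
      _ ≤ ∑ n ∈ range (N + 1), Λ' ^ (n + 1) / (n + 1).factorial := sum_le_sum fun n _ => he _
      _ ≤ ∑ m ∈ range (N + 2), Λ' ^ m / m.factorial := by
          rw [sum_range_succ' (fun m => Λ' ^ m / (m.factorial : ℝ)) (N + 1)]
          simp
      _ ≤ Real.exp Λ' := hexp _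
  have S4 : ∑ n ∈ Icc 1 N, ((n : ℝ) + 1) * e (n + 1) ≤ Λ' * Real.exp Λ' := by
    have key : ∑ n ∈ range (N + 1), ((n : ℝ) + 1) * (Λ' ^ (n + 1) / (n + 1).factorial) ≤
        ∑ m ∈ range (N + 2), ((m : ℝ) + 0) * (Λ' ^ m / m.factorial) := by
      rw [sum_range_succ' (fun m => ((m : ℝ) + 0) * (Λ' ^ m / (m.factorial : ℝ))) (N + 1)]
      simp only [Nat.cast_zero, add_zero, zero_mul, Nat.cast_add, Nat.cast_one]
      rfl
    calc ∑ n ∈ Icc 1 N, ((n : ℝ) + 1) * e (n + 1) ≤ ∑ n ∈ range (N + 1), ((n : ℝ) + 1) * e (n + 1) :=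
          sum_le_sum_of_subset_of_nonneg hsub fun n _ _ => mul_nonneg (by positivity) (he0 _)
      _ ≤ ∑ n ∈ range (N + 1), ((n : ℝ) + 1) * (Λ' ^ (n + 1) / (n + 1).factorial) :=
          sum_le_sum fun n _ => mul_le_mul_of_nonneg_left (he _) (by positivity)
      _ ≤ ∑ m ∈ range (N + 2), ((m : ℝ) + 0) * (Λ' ^ m / m.factorial) := key
      _ ≤ (Λ' + 0) * Real.exp Λ' := sum_add_mul_pow_div_factorial_le hΛ le_rfl _
      _ = Λ' * Real.exp Λ' := by ring
  have hsplit : ∑ n ∈ Icc 1 N, (a * e n + b * e (n - 1) + (c + d * ((n : ℝ) + 1)) * e (n + 1)) =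
      a * ∑ n ∈ Icc 1 N, e n + b * ∑ n ∈ Icc 1 N, e (n - 1) + c * ∑ n ∈ Icc 1 N, e (n + 1) +
        d * ∑ n ∈ Icc 1 N, ((n : ℝ) + 1) * e (n + 1) := by
    rw [mul_sum, mul_sum, mul_sum, mul_sum, ← sum_add_distrib, ← sum_add_distrib, ← sum_add_distrib]
    exact sum_congr rfl fun n _ => by ring
  rw [hsplit]
  have h1 := mul_le_mul_of_nonneg_left S1 ha
  have h2 := mul_le_mul_of_nonneg_left S2 hb
  have h3 := mul_le_mul_of_nonneg_left S3 hc
  have h4 := mul_le_mul_of_nonneg_left S4 hd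
  linarith

/-- `144 e^{Λ'} + 3Λ' e^{Λ'} ≤ 2295 τ^{-2}` for `Λ' = log(2/τ) + 2`, `0 < τ ≤ 1` (`e^{Λ'} = 2e²/τ ≤ 15/τ`,
`Λ' ≤ 2/τ + 1 ≤ 3/τ`). [folklore] -/
theorem ehat_total_le {τ : ℝ} (hτ : 0 < τ) (hτ1 : τ ≤ 1) :
    144 * Real.exp (Real.log (2 / τ) + 2) + 3 * ((Real.log (2 / τ) + 2) * Real.exp (Real.log (2 / τ) + 2)) ≤
      2295 / τ ^ 2 := by
  have h2τ : 0 < 2 / τ := by positivity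
  have hexp : Real.exp (Real.log (2 / τ) + 2) = 2 / τ * Real.exp 2 := by
    rw [Real.exp_add, Real.exp_log h2τ]
  have he2 : Real.exp 2 ≤ 15 / 2 := by
    have h := Real.exp_one_lt_d9
    have h0 := Real.exp_pos 1
    have : Real.exp 2 = Real.exp 1 ^ 2 := by rw [← Real.exp_nat_mul]; norm_num
    rw [this]; nlinarith
  have hE : Real.exp (Real.log (2 / τ) + 2) ≤ 15 / τ := by
    rw [hexp]
    calc 2 / τ * Real.exp 2 ≤ 2 / τ * (15 / 2) := mul_le_mul_of_nonneg_left he2 h2τ.le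
      _ = 15 / τ := by ring
  have hτinv1 : (1 : ℝ) ≤ 1 / τ := by rw [le_div_iff₀ hτ]; linarith
  have hΛ : Real.log (2 / τ) + 2 ≤ 3 / τ := by
    have h1 := Real.log_le_sub_one_of_pos h2τ
    have e1 : 2 / τ = 2 * (1 / τ) := by ring
    have e2 : 3 / τ = 3 * (1 / τ) := by ring
    rw [e1] at h1 ⊢; rw [e2]; linarith
  have hΛ0 : 0 ≤ Real.log (2 / τ) + 2 := by
    have : 0 ≤ Real.log (2 / τ) := Real.log_nonneg (by rw [le_div_iff₀ hτ]; linarith)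
    linarith
  have hE0 : 0 ≤ Real.exp (Real.log (2 / τ) + 2) := (Real.exp_pos _).le
  have hτinv : 1 / τ ≤ 1 / τ ^ 2 := by
    have : 1 / τ ^ 2 = (1 / τ) * (1 / τ) := by ring
    rw [this]; nlinarith
  have hprod : (Real.log (2 / τ) + 2) * Real.exp (Real.log (2 / τ) + 2) ≤ (3 / τ) * (15 / τ) :=
    mul_le_mul hΛ hE hE0 (by positivity)
  calc 144 * Real.exp (Real.log (2 / τ) + 2) + 3 * ((Real.log (2 / τ) + 2) * Real.exp (Real.log (2 / τ) + 2))
      ≤ 144 * (15 / τ) + 3 * ((3 / τ) * (15 / τ)) := by linarith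
    _ = 2160 * (1 / τ) + 135 * (1 / τ ^ 2) := by field_simp; ring
    _ ≤ 2160 * (1 / τ ^ 2) + 135 * (1 / τ ^ 2) := by linarith
    _ = 2295 / τ ^ 2 := by ring

/-- Scalar absorption for the `ℬ`-bounds: `E_B ≤ 2295 C_B X³X^{−τ/3}τ^{-2}`, the weight term and
the Lemma 7.1 error `X^{3−τ/5}` are together `≤ (C₇'(1600+700C₁) + 140C₇' + 2295C_B)·τ·ηX³/L`,
using `τ^{-1} ≤ L`, `X^{-τ/5}L³ ≤ τη²/L`. [folklore] -/
theorem B_final_absorb {X L τ η C₁ C₇' C_B EB : ℝ} (hX1 : 1 < X) (hL1 : 1 ≤ L) (hτ0 : 0 < τ)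
    (hη0 : 0 < η) (hη1 : η ≤ 1) (hC₇' : 0 ≤ C₇') (hC₁ : 0 ≤ C₁) (hCB : 0 ≤ C_B)
    (hτinvL : 1 / τ ≤ L) (habs' : X ^ (-τ / 5) * L ^ 3 ≤ τ * η ^ 2 / L)
    (hEB : EB ≤ C_B * X ^ 3 * X ^ (-(τ / 3)) * (2295 / τ ^ 2)) :
    EB + C₇' * (η * X ^ 3 / (τ * L)) * ((1600 + 700 * C₁) * τ ^ 2) +
        70 * (1 / τ + 1) * L * (C₇' * X ^ (3 - τ / 5)) ≤
      (C₇' * (1600 + 700 * C₁) + 140 * C₇' + 2295 * C_B) * τ * (η * X ^ 3 / L) := by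
  have hX0 : 0 < X := by linarith
  have hL0 : 0 < L := by linarith
  have hT0 : 0 ≤ τ * η * X ^ 3 / L := by positivity
  -- the E-terms
  have hτL2 : 1 / τ ^ 2 ≤ L ^ 2 := by
    have h0 : 0 ≤ 1 / τ := by positivity
    calc 1 / τ ^ 2 = (1 / τ) ^ 2 := by ring
      _ ≤ L ^ 2 := pow_le_pow_left₀ h0 hτinvL 2
  have hE1 : EB ≤ (2295 * C_B) * (X ^ 3 * X ^ (-(τ / 3)) * L ^ 2) := by
    refine hEB.trans ?_
    have h0 : 0 ≤ C_B * X ^ 3 * X ^ (-(τ / 3)) := by positivity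
    calc C_B * X ^ 3 * X ^ (-(τ / 3)) * (2295 / τ ^ 2) = (C_B * X ^ 3 * X ^ (-(τ / 3))) * 2295 * (1 / τ ^ 2) := by
          ring
      _ ≤ (C_B * X ^ 3 * X ^ (-(τ / 3))) * 2295 * L ^ 2 := mul_le_mul_of_nonneg_left hτL2 (by positivity)
      _ = (2295 * C_B) * (X ^ 3 * X ^ (-(τ / 3)) * L ^ 2) := by ring
  have hE2 : (2295 * C_B) * (X ^ 3 * X ^ (-(τ / 3)) * L ^ 2) ≤ (2295 * C_B) * (τ * η * X ^ 3 / L) :=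
    absorb_le3 hX1.le hL1 (by positivity) hη0.le hη1 hτ0.le (by linarith) (by norm_num) habs'
  -- the error term
  have hT3 : 70 * (1 / τ + 1) * L * (C₇' * X ^ (3 - τ / 5)) ≤ 140 * C₇' * (τ * η * X ^ 3 / L) := by
    have h0 : 0 ≤ L * (C₇' * X ^ (3 - τ / 5)) := by positivity
    have h1 : 70 * (1 / τ + 1) * L * (C₇' * X ^ (3 - τ / 5)) ≤ 70 * (2 * L) * L * (C₇' * X ^ (3 - τ / 5)) := by
      have : 70 * (1 / τ + 1) ≤ 70 * (2 * L) := by linarith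
      calc 70 * (1 / τ + 1) * L * (C₇' * X ^ (3 - τ / 5)) = 70 * (1 / τ + 1) * (L * (C₇' * X ^ (3 - τ / 5))) := by ring
        _ ≤ 70 * (2 * L) * (L * (C₇' * X ^ (3 - τ / 5))) := mul_le_mul_of_nonneg_right this h0
        _ = _ := by ring
    have h2 : 70 * (2 * L) * L * (C₇' * X ^ (3 - τ / 5)) = (140 * C₇') * (X ^ 3 * X ^ (-(τ / 5)) * L ^ 2) := by
      rw [rpow_three_sub hX0]; ring
    have h3 : (140 * C₇') * (X ^ 3 * X ^ (-(τ / 5)) * L ^ 2) ≤ (140 * C₇') * (τ * η * X ^ 3 / L) :=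
      absorb_le3 hX1.le hL1 (by positivity) hη0.le hη1 hτ0.le le_rfl (by norm_num) habs'
    linarith
  have hT2 : C₇' * (η * X ^ 3 / (τ * L)) * ((1600 + 700 * C₁) * τ ^ 2) =
      C₇' * (1600 + 700 * C₁) * (τ * η * X ^ 3 / L) := by
    field_simp
  rw [hT2]
  have hfin : (2295 * C_B) * (τ * η * X ^ 3 / L) + C₇' * (1600 + 700 * C₁) * (τ * η * X ^ 3 / L) +
      140 * C₇' * (τ * η * X ^ 3 / L) =
      (C₇' * (1600 + 700 * C₁) + 140 * C₇' + 2295 * C_B) * τ * (η * X ^ 3 / L) := by ring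
  linarith

/-- **The `ℬ`-side weights and the summed E-terms.** With `X^τ ≥ 16`, `12X^{−τ/3} ≤ 1` and the sharp
Mertens bound `∑_{P0} c_K(p)/p ≤ log(2/τ) + 1`: the divisor weights are `W₁ ≤ 12X^{−τ/3}`,
`W₂, W₃ ≤ 36X^{−τ}` (over the primes of norm `≤ 6X³` and over `𝒫₀`), and the per-`n` bounds of
`E1_B_le`, `E3ii_B_le`, `E4_B_le` sum to `≤ C_B X³X^{−τ/3}·2295τ^{-2}` over `1 ≤ n ≤ N`
(`∑_{𝒫₀} N(P)^{-1} ≤ Λ' = log(2/τ) + 2`, `ê_j ≤ Λ'^j/j!`, `sum_ehat_le`, `ehat_total_le`).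
[cite: HeathBrownActa2001, §7 pp. 43–46] -/
theorem B_Eterms_le (hX1 : 1 < X) (hτ0 : 0 < τ) (hτ1 : τ ≤ 1) (hXτ16 : 16 ≤ X ^ τ)
    (hXτ3 : 12 * X ^ (-(τ / 3)) ≤ 1) {C_B : ℝ} (hCB : 0 ≤ C_B)
    (hLt : ∑ p ∈ (range (⌊X ^ (1 - τ)⌋₊ + 1)).filter
        (fun p : ℕ => p.Prime ∧ X ^ τ ≤ (p : ℝ) ∧ (p : ℝ) < X ^ (1 - τ)),
        (idealNormCount K p : ℝ) * (p : ℝ)⁻¹ ≤ Real.log (2 / τ) + 1) (N : ℕ) :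
    (∑ P ∈ (Literature.NumberTheory.LFunctions.NumberField.finite_primeIdealsLE K (6 * X ^ 3)).toFinset.filter
        (fun P => ¬ (Ideal.absNorm P).Prime ∧ X ^ τ ≤ (Ideal.absNorm P : ℝ)),
        ((Ideal.absNorm P : ℕ) : ℝ)⁻¹ ≤ 12 * X ^ (-(τ / 3))) ∧
    (∑ P ∈ (Literature.NumberTheory.LFunctions.NumberField.finite_primeIdealsLE K (6 * X ^ 3)).toFinset.filter
        (fun P => (Ideal.absNorm P).Prime ∧ X ^ τ ≤ (Ideal.absNorm P : ℝ)),
        ((Ideal.absNorm P : ℕ) : ℝ)⁻¹ * ((Ideal.absNorm P : ℕ) : ℝ)⁻¹ ≤ 36 * X ^ (-τ)) ∧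
    (∑ x ∈ (((Literature.NumberTheory.LFunctions.NumberField.finite_primeIdealsLE K (6 * X ^ 3)).toFinset.filter
          (fun P => (Ideal.absNorm P).Prime ∧ X ^ τ ≤ (Ideal.absNorm P : ℝ))) ×ˢ
        ((Literature.NumberTheory.LFunctions.NumberField.finite_primeIdealsLE K (6 * X ^ 3)).toFinset.filter
          (fun P => (Ideal.absNorm P).Prime ∧ X ^ τ ≤ (Ideal.absNorm P : ℝ)))).filter
        (fun x => x.1 ≠ x.2 ∧ Ideal.absNorm x.1 = Ideal.absNorm x.2),
        ((Ideal.absNorm x.1 : ℕ) : ℝ)⁻¹ * ((Ideal.absNorm x.2 : ℕ) : ℝ)⁻¹ ≤ 36 * X ^ (-τ)) ∧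
    (∑ P ∈ (smallPrimes X τ).filter (fun P => ¬ (Ideal.absNorm P).Prime),
        ((Ideal.absNorm P : ℕ) : ℝ)⁻¹ ≤ 12 * X ^ (-(τ / 3))) ∧
    (∑ x ∈ (smallPrimes X τ ×ˢ smallPrimes X τ).filter
        (fun x => x.1 ≠ x.2 ∧ Ideal.absNorm x.1 = Ideal.absNorm x.2),
        ((Ideal.absNorm x.1 : ℕ) : ℝ)⁻¹ * ((Ideal.absNorm x.2 : ℕ) : ℝ)⁻¹ ≤ 36 * X ^ (-τ)) ∧
    ∑ n ∈ Icc 1 N,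
      (C_B * X ^ 3 * ((12 * X ^ (-(τ / 3))) *
            ∑ s ∈ (smallPrimes X τ).powersetCard n, ∏ P ∈ s, ((Ideal.absNorm P : ℕ) : ℝ)⁻¹ +
          (36 * X ^ (-τ)) *
            ∑ s ∈ (smallPrimes X τ).powersetCard (n - 1), ∏ P ∈ s, ((Ideal.absNorm P : ℕ) : ℝ)⁻¹) +
        C_B * X ^ 3 * ((12 * X ^ (-(τ / 3))) + 3 * ((n : ℝ) + 1) * (X ^ τ)⁻¹) *
            ∑ s ∈ (smallPrimes X τ).powersetCard (n + 1), ∏ P ∈ s, ((Ideal.absNorm P : ℕ) : ℝ)⁻¹ +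
        C_B * X ^ 3 * (12 * X ^ (-(τ / 3)) + 36 * X ^ (-τ) + 36 * X ^ (-τ)) *
            ∑ s ∈ (smallPrimes X τ).powersetCard (n + 1), ∏ P ∈ s, ((Ideal.absNorm P : ℕ) : ℝ)⁻¹) ≤
      C_B * X ^ 3 * X ^ (-(τ / 3)) * (2295 / τ ^ 2) := by
  classical
  have hX0 : 0 < X := by linarith
  -- scalar facts
  have hY2 : (2 : ℝ) ≤ X ^ τ / 2 := by linarith
  have hYlt : X ^ τ / 2 < X ^ τ := by linarith
  have hinvY : 18 / (X ^ τ / 2) = 36 * X ^ (-τ) := by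
    rw [Real.rpow_neg hX0.le]; field_simp; ring
  have hXτinv : (X ^ τ)⁻¹ = X ^ (-τ) := (Real.rpow_neg hX0.le τ).symm
  have hmono : X ^ (-τ) ≤ X ^ (-(τ / 3)) := Real.rpow_le_rpow_of_exponent_le hX1.le (by linarith)
  have hXτ3pos : 0 ≤ X ^ (-(τ / 3)) := by positivity
  have hXτpos' : 0 ≤ X ^ (-τ) := by positivity
  have hlog2τ : 0 ≤ Real.log (2 / τ) := Real.log_nonneg (by rw [le_div_iff₀ hτ0]; linarith)
  set Λ' : ℝ := Real.log (2 / τ) + 2 with hΛ'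
  have hΛ'0 : 0 ≤ Λ' := by rw [hΛ']; linarith
  have hΛ2 : Real.log (2 / τ) + 1 + 1 = Λ' := by rw [hΛ']; ring
  have h144 : 12 * X ^ (-(τ / 3)) + 36 * X ^ (-τ) + (24 * X ^ (-(τ / 3)) + 72 * X ^ (-τ)) ≤
      144 * X ^ (-(τ / 3)) := by linarith
  have h3mono : 3 * X ^ (-τ) ≤ 3 * X ^ (-(τ / 3)) := by linarith
  have htot := ehat_total_le hτ0 hτ1
  -- the weights
  set sP := smallPrimes X τ with hsP
  set PI := (Literature.NumberTheory.LFunctions.NumberField.finite_primeIdealsLE K (6 * X ^ 3)).toFinset with hPI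
  have hsPmem : ∀ P ∈ sP, P.IsPrime ∧ P ≠ ⊥ := fun P hP =>
    ⟨(mem_smallPrimes_iff.mp hP).1, (mem_smallPrimes_iff.mp hP).2.1⟩
  have hPImem : ∀ P ∈ PI, P.IsPrime ∧ P ≠ ⊥ := fun P hP => by
    rw [hPI, Set.Finite.mem_toFinset] at hP; exact ⟨hP.1, hP.2.1⟩
  obtain ⟨hW1, hW2, hW3⟩ := defect_weights_B_le hX0 hXτ16 PI hPImem
  obtain ⟨hW1s', -, -⟩ := defect_weights_B_le hX0 hXτ16 sP hsPmem
  have hW1s : ∑ P ∈ sP.filter (fun P => ¬ (Ideal.absNorm P).Prime), ((Ideal.absNorm P : ℕ) : ℝ)⁻¹ ≤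
      12 * X ^ (-(τ / 3)) := by
    have heq : sP.filter (fun P => ¬ (Ideal.absNorm P).Prime) =
        sP.filter (fun P => ¬ (Ideal.absNorm P).Prime ∧ X ^ τ ≤ (Ideal.absNorm P : ℝ)) :=
      filter_congr fun P hP => ⟨fun h => ⟨h, (mem_smallPrimes_iff.mp hP).2.2.1⟩, fun h => h.1⟩
    rw [heq]; exact hW1s'
  have hW2s : ∑ x ∈ (sP ×ˢ sP).filter (fun x => x.1 ≠ x.2 ∧ Ideal.absNorm x.1 = Ideal.absNorm x.2),
      ((Ideal.absNorm x.1 : ℕ) : ℝ)⁻¹ * ((Ideal.absNorm x.2 : ℕ) : ℝ)⁻¹ ≤ 36 * X ^ (-τ) := by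
    have h := sum_inv_absNorm_pair_eq_le hY2 ((sP ×ˢ sP).filter
        (fun x => x.1 ≠ x.2 ∧ Ideal.absNorm x.1 = Ideal.absNorm x.2)) fun x hx => by
      rw [mem_filter, mem_product] at hx
      obtain ⟨⟨h1, h2⟩, -, hN⟩ := hx
      have h1' := mem_smallPrimes_iff.mp h1
      have h2' := mem_smallPrimes_iff.mp h2
      exact ⟨h1'.1, h1'.2.1, h2'.1, h2'.2.1, hN, lt_of_lt_of_le hYlt h1'.2.2.1⟩
    rw [hinvY] at h
    exact h
  refine ⟨hW1, hW2, hW3, hW1s, hW2s, ?_⟩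
  -- `∑_{𝒫₀} N(P)^{-1} ≤ Λ' = log(2/τ) + 2`
  set P0 := (range (⌊X ^ (1 - τ)⌋₊ + 1)).filter
    (fun p : ℕ => p.Prime ∧ X ^ τ ≤ (p : ℝ) ∧ (p : ℝ) < X ^ (1 - τ)) with hP0
  set w : Ideal (𝓞 K) → ℝ := fun P => ((Ideal.absNorm P : ℕ) : ℝ)⁻¹ with hw
  have hw0 : ∀ P ∈ sP, 0 ≤ w P := fun P _ => by simp only [hw]; positivity
  have hLtot : ∑ P ∈ sP, w P ≤ Λ' := by
    rw [← sum_filter_add_sum_filter_not sP (fun P => (Ideal.absNorm P).Prime)]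
    have h1 : ∑ P ∈ sP.filter (fun P => (Ideal.absNorm P).Prime), w P ≤ Real.log (2 / τ) + 1 := by
      have hsub : sP.filter (fun P => (Ideal.absNorm P).Prime) ⊆ normIn P0 := by
        intro P hP
        obtain ⟨hPs, hpr⟩ := mem_filter.mp hP
        obtain ⟨-, -, hlo, hhi⟩ := mem_smallPrimes_iff.mp hPs
        rw [mem_normIn_iff, hP0, mem_filter, mem_range, Nat.lt_add_one_iff]
        exact ⟨Nat.le_floor hhi.le, hpr, hlo, hhi⟩
      calc ∑ P ∈ sP.filter (fun P => (Ideal.absNorm P).Prime), w P ≤ ∑ Q ∈ normIn P0, w Q :=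
            sum_le_sum_of_subset_of_nonneg hsub fun _ _ _ => by simp only [hw]; positivity
        _ = ∑ p ∈ P0, (idealNormCount K p : ℝ) * (p : ℝ)⁻¹ := sum_normIn_inv_absNorm_eq P0
        _ ≤ Real.log (2 / τ) + 1 := hLt
    have h2 : ∑ P ∈ sP.filter (fun P => ¬ (Ideal.absNorm P).Prime), w P ≤ 1 := hW1s.trans hXτ3
    rw [← hΛ2]
    exact add_le_add h1 h2
  -- the sums `ê_j`
  set e : ℕ → ℝ := fun j => ∑ s ∈ sP.powersetCard j, ∏ P ∈ s, w P with he
  have he0 : ∀ j, 0 ≤ e j := fun j => esymm_nonneg sP w hw0 j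
  have heΛ : ∀ j, e j ≤ Λ' ^ j / j.factorial := fun j =>
    (esymm_le_pow_div_factorial sP w hw0 j).trans
      (div_le_div_of_nonneg_right (pow_le_pow_left₀ (sum_nonneg hw0) hLtot j) (by positivity))
  -- the per-`n` bounds summed
  change ∑ n ∈ Icc 1 N,
      (C_B * X ^ 3 * ((12 * X ^ (-(τ / 3))) * e n + (36 * X ^ (-τ)) * e (n - 1)) +
        C_B * X ^ 3 * ((12 * X ^ (-(τ / 3))) + 3 * ((n : ℝ) + 1) * (X ^ τ)⁻¹) * e (n + 1) +
        C_B * X ^ 3 * (12 * X ^ (-(τ / 3)) + 36 * X ^ (-τ) + 36 * X ^ (-τ)) * e (n + 1)) ≤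
      C_B * X ^ 3 * X ^ (-(τ / 3)) * (2295 / τ ^ 2)
  have hre : ∀ n ∈ Icc 1 N,
      C_B * X ^ 3 * ((12 * X ^ (-(τ / 3))) * e n + (36 * X ^ (-τ)) * e (n - 1)) +
        C_B * X ^ 3 * ((12 * X ^ (-(τ / 3))) + 3 * ((n : ℝ) + 1) * (X ^ τ)⁻¹) * e (n + 1) +
        C_B * X ^ 3 * (12 * X ^ (-(τ / 3)) + 36 * X ^ (-τ) + 36 * X ^ (-τ)) * e (n + 1) =
      C_B * X ^ 3 * ((12 * X ^ (-(τ / 3))) * e n + (36 * X ^ (-τ)) * e (n - 1) +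
        ((24 * X ^ (-(τ / 3)) + 72 * X ^ (-τ)) + (3 * X ^ (-τ)) * ((n : ℝ) + 1)) * e (n + 1)) := by
    intro n _; rw [hXτinv]; ring
  rw [sum_congr rfl hre, ← mul_sum]
  have hs := sum_ehat_le hΛ'0 (by positivity : (0 : ℝ) ≤ 12 * X ^ (-(τ / 3)))
    (by positivity : (0 : ℝ) ≤ 36 * X ^ (-τ))
    (by positivity : (0 : ℝ) ≤ 24 * X ^ (-(τ / 3)) + 72 * X ^ (-τ))
    (by positivity : (0 : ℝ) ≤ 3 * X ^ (-τ)) e he0 heΛ N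
  rw [mul_assoc (C_B * X ^ 3)]
  refine mul_le_mul_of_nonneg_left (hs.trans ?_) (by positivity)
  have hE0 : 0 ≤ Real.exp Λ' := (Real.exp_pos _).le
  have hΛE0 : 0 ≤ Λ' * Real.exp Λ' := mul_nonneg hΛ'0 hE0
  calc (12 * X ^ (-(τ / 3)) + 36 * X ^ (-τ) + (24 * X ^ (-(τ / 3)) + 72 * X ^ (-τ))) * Real.exp Λ' +
        3 * X ^ (-τ) * (Λ' * Real.exp Λ')
      ≤ (144 * X ^ (-(τ / 3))) * Real.exp Λ' + 3 * X ^ (-(τ / 3)) * (Λ' * Real.exp Λ') :=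
        add_le_add (mul_le_mul_of_nonneg_right h144 hE0) (mul_le_mul_of_nonneg_right h3mono hΛE0)
    _ = X ^ (-(τ / 3)) * (144 * Real.exp Λ' + 3 * (Λ' * Real.exp Λ')) := by ring
    _ ≤ X ^ (-(τ / 3)) * (2295 / τ ^ 2) := mul_le_mul_of_nonneg_left htot hXτ3pos

/-- **The `U`-part of Lemma 3.7 for `ℬ^(K)`, summed over `n`**: from the corrected Lemma 7.1,
`∑_{1 ≤ n ≤ n₀} |U₁^(n)(ℬ) − Û^(n)(ℬ)| ≤ C ξτ^{-4} ηX³/log X` for `X ≥ X₀` and `η` in (2.1)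
(`U_sum_bound`; E1, E3ii, E4 `≪ X³X^{−τ/3}τ^{-2}` by (7.7), absorbed with the Lemma 7.1 error
`X^{3−τ/5}` by (2.1), (2.5)). Also records `1 < X`, `0 < τ ≤ 1/40`.
[cite: HeathBrownActa2001, Lemma 3.7, §7 pp. 42–46] -/
theorem U_B_sum_bound (h71 : HeathBrown2001_lemma_7_1_normWeighted) {ϖ : ℝ} (hϖ0 : 0 < ϖ)
    (hϖ1 : ϖ < 1 / 5) :
    ∃ C X₀ : ℝ, ∀ X η : ℝ, X₀ ≤ X → Real.exp (-Real.log X ^ (1 / 3 : ℝ)) ≤ η → η ≤ 1 →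
      1 < X ∧ 0 < hbTau ϖ X ∧ hbTau ϖ X ≤ 1 / 40 ∧
      ∑ n ∈ Icc 1 (chainBound (hbTau ϖ X)),
          |(U1piece (normWindow X η) (fun J => J) X (hbTau ϖ X) n : ℝ) -
              Uhat X (hbTau ϖ X) (normWindow X η) (fun J => J) n| ≤
        C * (hbXi (hbTau ϖ X) / hbTau ϖ X ^ 4) * (η * X ^ 3 / Real.log X) := by
  classical
  obtain ⟨C₇, X₇, h7⟩ := h71 ϖ hϖ0 hϖ1
  obtain ⟨C₁, hC₁, hwin⟩ := exists_sum_normWt_window_le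
  obtain ⟨C_B, hCBpos, hcountB⟩ := exists_countB_le
  have hCB : 0 ≤ C_B := hCBpos.le
  have hϖ1' : ϖ ≤ 1 := by linarith
  set C₇' : ℝ := max C₇ 1 with hC₇'
  have hC₇'0 : 0 ≤ C₇' := le_trans zero_le_one (le_max_right _ _)
  have hCC : C₇ ≤ C₇' := le_max_left _ _
  have hcpos : 0 < min (1 / 40 : ℝ) (1 / (2 * C₁ + 1)) := lt_min (by norm_num) (by positivity)
  obtain ⟨X₁, hX₁⟩ := Filter.eventually_atTop.mp
    ((eventually_upperBound_params hϖ0 hϖ1' one_pos 3).and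
      ((eventually_le_hbTau_mul_log hϖ1' 8).and
        ((eventually_hbTau_pow_mul_log hϖ0 hϖ1' 5 12 hcpos).and
          (eventually_ge_atTop (max X₇ ((2 : ℝ) ^ 15))))))
  refine ⟨C₇' * (1600 + 700 * C₁) + 140 * C₇' + 2295 * C_B, X₁, fun X η hX hη hη1 => ?_⟩
  obtain ⟨⟨-, hτ0, hτ8, hlogτ, habs⟩, hτL8, ⟨h12, hτc⟩, hXmax⟩ := hX₁ X hX
  clear hX₁
  set τ := hbTau ϖ X with hτdef
  have hX15 : (2 : ℝ) ^ 15 ≤ X := le_trans (le_max_right _ _) hXmax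
  have hX7 : X₇ ≤ X := le_trans (le_max_left _ _) hXmax
  have hX1 : 1 < X := lt_of_lt_of_le (by norm_num) hX15
  have hX0 : 0 < X := by linarith
  set L := Real.log X with hL
  have hL10 : 10 ≤ L := ten_le_log hX15
  have hL1 : 1 ≤ L := by linarith
  have hL0 : 0 < L := by linarith
  have hη0 : 0 < η := lt_of_lt_of_le (Real.exp_pos _) hη
  have hτ1 : τ ≤ 1 := by linarith
  have hτ40 : τ ≤ 1 / 40 := hτc.trans (min_le_left _ _)
  have hC₁τ : 2 * C₁ * τ ^ 4 ≤ 1 := by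
    have h1 : τ ≤ 1 / (2 * C₁ + 1) := hτc.trans (min_le_right _ _)
    have h2 : τ ^ 4 ≤ τ := pow_le_of_le_one hτ0.le hτ1 (by norm_num)
    have h3 : 2 * C₁ * τ ≤ 2 * C₁ * (1 / (2 * C₁ + 1)) := mul_le_mul_of_nonneg_left h1 (by positivity)
    have h4 : 2 * C₁ * (1 / (2 * C₁ + 1)) ≤ 1 := by
      rw [mul_one_div, div_le_one (by positivity)]; linarith
    have h5 : 2 * C₁ * τ ^ 4 ≤ 2 * C₁ * τ := mul_le_mul_of_nonneg_left h2 (by positivity)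
    linarith
  have hLτ : 1 / L ≤ τ ^ 5 := by rw [div_le_iff₀ hL0]; linarith
  have hτinvL : 1 / τ ≤ L := by
    rw [div_le_iff₀ hτ0]
    have := mul_le_mul_of_nonneg_left hlogτ hL0.le
    rw [mul_inv_cancel₀ hL0.ne'] at this
    linarith
  have hτL5 : 1 ≤ τ ^ 5 * L := by linarith
  have h2C : 2 * C₁ / (τ * L) ≤ 1 := by
    rw [div_le_iff₀ (by positivity), one_mul]
    calc 2 * C₁ ≤ 2 * C₁ * (τ ^ 5 * L) := le_mul_of_one_le_right (by positivity) hτL5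
      _ = (2 * C₁ * τ ^ 4) * (τ * L) := by ring
      _ ≤ 1 * (τ * L) := mul_le_mul_of_nonneg_right hC₁τ (by positivity)
      _ = τ * L := one_mul _
  -- `X^τ ≥ e⁸ ≥ 1728`, so `X^τ ≥ 16`, `12 X^{-τ/3} ≤ 1`, `6 < X^{3τ}`
  have he27 : (2.7 : ℝ) < Real.exp 1 := by have := Real.exp_one_gt_d9; linarith
  have hXτe : Real.exp 8 ≤ X ^ τ := by
    rw [Real.rpow_def_of_pos hX0, ← hL]
    exact Real.exp_le_exp.mpr (by nlinarith)
  have he8 : (1728 : ℝ) ≤ Real.exp 8 := by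
    have h3 : Real.exp 8 = Real.exp 1 ^ 8 := by rw [← Real.exp_nat_mul]; norm_num
    rw [h3]
    calc (1728 : ℝ) ≤ (2.7 : ℝ) ^ 8 := by norm_num
      _ ≤ Real.exp 1 ^ 8 := pow_le_pow_left₀ (by norm_num) he27.le 8
  have hXτ16 : 16 ≤ X ^ τ := by linarith
  have hXτ4 : 4 ≤ X ^ τ := by linarith
  have hXτ3 : 12 * X ^ (-(τ / 3)) ≤ 1 := by
    have h0 : 0 < X ^ (τ / 3) := Real.rpow_pos_of_pos hX0 _
    have hcube : (X ^ (τ / 3)) ^ 3 = X ^ τ := by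
      rw [← Real.rpow_natCast, ← Real.rpow_mul hX0.le]; ring_nf
    have h12 : (12 : ℝ) ≤ X ^ (τ / 3) := by
      refine le_of_pow_le_pow_left₀ (by norm_num : (3 : ℕ) ≠ 0) h0.le ?_
      rw [hcube]; linarith
    rw [Real.rpow_neg hX0.le, ← div_eq_mul_inv, div_le_one h0]
    exact h12
  have hCN : (6 : ℝ) < X ^ (3 * τ) := by
    have h1 : X ^ τ ≤ X ^ (3 * τ) := Real.rpow_le_rpow_of_exponent_le hX1.le (by linarith)
    linarith
  -- `2X^τ ≤ X^{1/2}`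
  have hXτ2 : 2 * X ^ τ ≤ X ^ (1 / 2 : ℝ) := by
    have h1 : X ^ (1 / 2 : ℝ) = X ^ τ * X ^ (1 / 2 - τ) := by
      rw [← Real.rpow_add hX0]; ring_nf
    have h2 : (2 : ℝ) ≤ X ^ (1 / 2 - τ) := by
      have h3 : (16 : ℝ) ^ (1 / 4 : ℝ) = 2 := by
        rw [show (16 : ℝ) = 2 ^ (4 : ℝ) by norm_num, ← Real.rpow_mul (by norm_num)]; norm_num
      calc (2 : ℝ) = 16 ^ (1 / 4 : ℝ) := h3.symm
        _ ≤ X ^ (1 / 4 : ℝ) := Real.rpow_le_rpow (by norm_num) (by linarith) (by norm_num)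
        _ ≤ X ^ (1 / 2 - τ) := Real.rpow_le_rpow_of_exponent_le hX1.le (by linarith)
    rw [h1]
    have h0 : 0 < X ^ τ := Real.rpow_pos_of_pos hX0 τ
    nlinarith
  have hΛ1 : Real.log (2 / τ) + 2 * C₁ / (τ * L) ≤ Real.log (2 / τ) + 1 := by linarith
  have hη2 : Real.exp (-2 * L ^ (1 / 3 : ℝ)) ≤ η ^ 2 := by
    have : Real.exp (-2 * L ^ (1 / 3 : ℝ)) = Real.exp (-L ^ (1 / 3 : ℝ)) ^ 2 := by
      rw [← Real.exp_nat_mul]; ring_nf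
    rw [this]
    exact pow_le_pow_left₀ (Real.exp_pos _).le hη 2
  have habs' : X ^ (-τ / 5) * L ^ 3 ≤ τ * η ^ 2 / L := by
    rw [one_mul] at habs
    refine habs.trans ?_
    exact div_le_div_of_nonneg_right (mul_le_mul_of_nonneg_left hη2 hτ0.le) hL0.le
  -- the sharp Mertens input and the E-term bundle
  have hP0mem : ∀ p ∈ (range (⌊X ^ (1 - τ)⌋₊ + 1)).filter
      (fun p : ℕ => p.Prime ∧ X ^ τ ≤ (p : ℝ) ∧ (p : ℝ) < X ^ (1 - τ)),
      p.Prime ∧ X ^ τ ≤ (p : ℝ) ∧ (p : ℝ) < X ^ (1 - τ) := fun p hp => (mem_filter.mp hp).2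
  have hLt := (smallPrimes_normWt_le hC₁ hwin hX1 hτ0 (by linarith) hXτ4 _ hP0mem).trans hΛ1
  obtain ⟨hW1, hW2, hW3, hW1s, hW2s, hEB⟩ := B_Eterms_le hX1 hτ0 hτ1 hXτ16 hXτ3 hCB hLt (chainBound τ)
  -- members of `ℬ^(K)` and (7.7)
  have hE : ∀ J ∈ normWindow X η, (fun J => J) J ≠ ⊥ ∧ (Ideal.absNorm ((fun J => J) J) : ℝ) ≤ 6 * X ^ 3 :=
    fun J hJ => ⟨ne_bot_of_mem_normWindow hX0.le J hJ, (absNorm_normWindow_bounds hX0 hη1 hJ).2⟩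
  have hcB : ∀ R : Ideal (𝓞 K), R ≠ ⊥ → (countB X η R : ℝ) ≤ C_B * X ^ 3 / Ideal.absNorm R :=
    hcountB X η hX0.le hη0.le hη1
  clear hcountB
  -- Lemma 7.1 for `ℬ`
  have h7B : ∀ (N z : ℝ) (𝒬 : Finset ℕ), X ^ τ ≤ z → 0 < N → N ≤ X ^ (2 - 2 * τ) →
      (∀ q ∈ 𝒬, Squarefree q ∧ N < q ∧ (q : ℝ) ≤ 2 * N) →
      ∑ Q ∈ normIn 𝒬, (famSifted (normWindow X η) (fun J => J) Q z : ℝ) ≤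
        C₇' * (η * X ^ 3 / Real.log (min z (X ^ (2 - τ) / N)) *
          ∑ Q ∈ normIn 𝒬, ((Ideal.absNorm Q : ℕ) : ℝ)⁻¹ + X ^ (3 - τ / 5)) := by
    intro N z 𝒬 hz hN hNX h𝒬
    have h := (h7 X η hX7 hη hη1 N z 𝒬 hz hN hNX h𝒬).2
    simp_rw [siftedB_eq_famSifted] at h
    refine h.trans (mul_le_mul_of_nonneg_right hCC ?_)
    have hlogmin : 0 ≤ Real.log (min z (X ^ (2 - τ) / N)) := by
      refine Real.log_nonneg ?_
      have hz1 : 1 ≤ z := le_trans (Real.one_le_rpow hX1.le hτ0.le) hz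
      have h2 : 1 ≤ X ^ (2 - τ) / N := by
        rw [le_div_iff₀ hN, one_mul]
        exact hNX.trans (Real.rpow_le_rpow_of_exponent_le hX1.le (by linarith))
      exact le_min hz1 h2
    have : 0 ≤ ∑ Q ∈ normIn 𝒬, ((Ideal.absNorm Q : ℕ) : ℝ)⁻¹ := sum_nonneg fun _ _ => by positivity
    positivity
  have hN : ((chainBound τ : ℕ) : ℝ) ≤ 1 / τ + 1 := by
    rw [chainBound]; push_cast
    linarith [Nat.floor_le (by positivity : (0 : ℝ) ≤ 1 / τ)]
  have hsum := U_sum_bound (normWindow X η) (fun J => J) hC₁ hwin hX15 hτ0 hτ40 hXτ4 hXτ2 hCN hE hC₇'0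
    (M := η * X ^ 3) (by positivity) (Err := X ^ (3 - τ / 5)) (by positivity) h7B hLτ hC₁τ hN
  refine ⟨hX1, hτ0, hτ40, hsum.trans ?_⟩
  clear hsum h7B h7 hE hwin
  have hscale : hbXi τ / τ ^ 4 = τ := hbXi_div_pow_four hτ0.ne'
  rw [hscale]
  -- assemble
  calc _ ≤ ∑ n ∈ Icc 1 (chainBound τ),
        (C_B * X ^ 3 * ((12 * X ^ (-(τ / 3))) *
              ∑ s ∈ (smallPrimes X τ).powersetCard n, ∏ P ∈ s, ((Ideal.absNorm P : ℕ) : ℝ)⁻¹ +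
            (36 * X ^ (-τ)) *
              ∑ s ∈ (smallPrimes X τ).powersetCard (n - 1), ∏ P ∈ s, ((Ideal.absNorm P : ℕ) : ℝ)⁻¹) +
          C_B * X ^ 3 * ((12 * X ^ (-(τ / 3))) + 3 * ((n : ℝ) + 1) * (X ^ τ)⁻¹) *
              ∑ s ∈ (smallPrimes X τ).powersetCard (n + 1), ∏ P ∈ s, ((Ideal.absNorm P : ℕ) : ℝ)⁻¹ +
          C_B * X ^ 3 * (12 * X ^ (-(τ / 3)) + 36 * X ^ (-τ) + 36 * X ^ (-τ)) *
              ∑ s ∈ (smallPrimes X τ).powersetCard (n + 1), ∏ P ∈ s, ((Ideal.absNorm P : ℕ) : ℝ)⁻¹) +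
        C₇' * (η * X ^ 3 / (τ * L)) * ((1600 + 700 * C₁) * τ ^ 2) +
        70 * (1 / τ + 1) * L * (C₇' * X ^ (3 - τ / 5)) := by
        refine add_le_add (add_le_add (sum_le_sum fun n hn => ?_) le_rfl) le_rfl
        have hn1 : 1 ≤ n := (mem_Icc.mp hn).1
        exact add_le_add (add_le_add (E1_B_le hX0.le hCB hcB hW1s hW2s hn1)
          (E3ii_B_le hX1 hτ0 hτ1 hCB hcB hW1 n))
          (E4_B_le hX1 hτ0 hτ1 hη1 hCB hcB (add_le_add (add_le_add hW1 hW2) hW3) n)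
    _ ≤ (C₇' * (1600 + 700 * C₁) + 140 * C₇' + 2295 * C_B) * τ * (η * X ^ 3 / L) :=
        B_final_absorb hX1 hL1 hτ0 hη0 hη1 hC₇'0 hC₁ hCB hτinvL habs' hEB

/-- **Lemma 3.7, the three `U`-bounds for `ℬ^(K)`** from the corrected Lemma 7.1:
`∑_{3 ≤ n ≤ n₀} |U^(n) − Û^(n)|`, `|U₁^(1) − Û^(1)|`, `|U₁^(2) − Û^(2)|` are each
`≤ C ξτ^{-4} ηX³/log X` for `X ≥ X₀`, `η` in (2.1). [cite: HeathBrownActa2001, Lemma 3.7] -/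
theorem U_B_bounds (h71 : HeathBrown2001_lemma_7_1_normWeighted) {ϖ : ℝ} (hϖ0 : 0 < ϖ)
    (hϖ1 : ϖ < 1 / 5) :
    ∃ C X₀ : ℝ, ∀ X η : ℝ, X₀ ≤ X → Real.exp (-Real.log X ^ (1 / 3 : ℝ)) ≤ η → η ≤ 1 →
      (∑ n ∈ Icc 3 (chainBound (hbTau ϖ X)),
          |(Upiece (normWindow X η) (fun J => J) X (hbTau ϖ X) n : ℝ) -
              Uhat X (hbTau ϖ X) (normWindow X η) (fun J => J) n| ≤
        C * (hbXi (hbTau ϖ X) / hbTau ϖ X ^ 4) * (η * X ^ 3 / Real.log X)) ∧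
      (|(U1piece (normWindow X η) (fun J => J) X (hbTau ϖ X) 1 : ℝ) -
            Uhat X (hbTau ϖ X) (normWindow X η) (fun J => J) 1| ≤
        C * (hbXi (hbTau ϖ X) / hbTau ϖ X ^ 4) * (η * X ^ 3 / Real.log X)) ∧
      (|(U1piece (normWindow X η) (fun J => J) X (hbTau ϖ X) 2 : ℝ) -
            Uhat X (hbTau ϖ X) (normWindow X η) (fun J => J) 2| ≤
        C * (hbXi (hbTau ϖ X) / hbTau ϖ X ^ 4) * (η * X ^ 3 / Real.log X)) := by
  obtain ⟨C, X₀, h⟩ := U_B_sum_bound h71 hϖ0 hϖ1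
  refine ⟨C, X₀, fun X η hX hη hη1 => ?_⟩
  obtain ⟨hX1, hτ0, hτ40, hsum⟩ := h X η hX hη hη1
  set τ := hbTau ϖ X with hτ
  set N := chainBound τ with hN
  have hnonneg : ∀ n ∈ Icc 1 N, 0 ≤ |(U1piece (normWindow X η) (fun J => J) X τ n : ℝ) -
      Uhat X τ (normWindow X η) (fun J => J) n| := fun _ _ => abs_nonneg _
  have hN2 : 2 ≤ N := by
    rw [hN, chainBound]
    have : 1 ≤ ⌊1 / τ⌋₊ := Nat.le_floor (by
      rw [Nat.cast_one, le_div_iff₀ hτ0]; linarith)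
    omega
  refine ⟨?_, ?_, ?_⟩
  · calc ∑ n ∈ Icc 3 N, |(Upiece (normWindow X η) (fun J => J) X τ n : ℝ) -
          Uhat X τ (normWindow X η) (fun J => J) n|
        = ∑ n ∈ Icc 3 N, |(U1piece (normWindow X η) (fun J => J) X τ n : ℝ) -
            Uhat X τ (normWindow X η) (fun J => J) n| := by
          refine sum_congr rfl fun n hn => ?_
          rw [Upiece_eq_U1piece (normWindow X η) (fun J => J) hX1 hτ0 (by linarith) (mem_Icc.mp hn).1]
      _ ≤ ∑ n ∈ Icc 1 N, |(U1piece (normWindow X η) (fun J => J) X τ n : ℝ) -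
            Uhat X τ (normWindow X η) (fun J => J) n| :=
          sum_le_sum_of_subset_of_nonneg (fun n hn => by
            rw [mem_Icc] at hn ⊢; omega) fun n _ _ => abs_nonneg _
      _ ≤ _ := hsum
  · have h1 : 1 ∈ Icc 1 N := by rw [mem_Icc]; omega
    exact (single_le_sum hnonneg h1).trans hsum
  · have h2 : 2 ∈ Icc 1 N := by rw [mem_Icc]; omega
    exact (single_le_sum hnonneg h2).trans hsum

end FamilyB

end Literature.NumberTheory.Sieve.CubicSieve

end
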